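/-
Copyright (c) 2026 the pub-hodgecm-mathlib formalisation cell (harness21).  Prover seat hodgecm-mathlib-LH3-p04 (g4): line LH3 (closer stub `stub_N9`), leaf organ O-L1d′ (hCm),
brick **(M2) «ONE-PLACE PARAMETRIC BOX DESCENT TO `U(J)`»** (LH3-plan (g4) RULING #20 2026-09-02T12:01:53Z; binder of record F0P3a-p08 (g23)).
-/
import Literature.NumberTheory.Rogawski1990.ArchOrbFamGExtTwoBlockBoxDescent          -- ★ p851307 (this seat): brings the whole (B-desc)∕(X2) tool chain (block lemmas, (B-STD), cut-offs, Hörmander engine)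
import Literature.NumberTheory.Automorphic.ArchInnerFormChartOrbLocal                   -- ★ `compactSpace_chartTorusGLoc_of_not_mem`; brings ★ `ArchInnerFormChartLocal` (`gprimeBlockAt`, `chartTorusGLoc`, `mem_chartTorusGLoc_iff`)
import Literature.MeasureTheory.Group.InvariantQuotientCompactSubgroup                  -- ★ `quotientMeasure_eq_inv_smul_map_mk`
import Literature.NumberTheory.Automorphic.UnitaryFormGroupTestFunctionExtension        -- ★ `isClosedEmbedding_coe_unitaryGroupOfForm`
import Literature.NumberTheory.Rogawski1990.ArchOrbFamGSmoothModel                    -- ★ (A4) p850939 (LH5-p02): `contDiff_coe_gprimeBlock`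
import HarnessLib

/-!
# (M2) ONE-PLACE PARAMETRIC BOX DESCENT: the orbital integral over ONE local group `G_w = U(α)_w` of a smooth family of test functions near a noncompact-wall face value
# descends to the rank-one block `U(J)` — `∫_{G_w} Θ(π, g·γ_w(c)·g⁻¹) dν_w = K · ∫_{U(J)} f((π, c), ↑↑(h · P diag(e^{ic_0}, e^{ic_2}) P⁻¹ · h⁻¹)) dμ₀(h)`, `f` jointly `C^∞`
# (Rogawski 1990 §4.12 Lemma 4.12.1, §8.2 pp. 119–124; Harish-Chandra–van Dijk 1970 I §3)

Topic `NumberTheory/Rogawski1990`; namespace `Literature.NumberTheory.Rogawski1990`.  THEOREMS ONLY (no `def`, no instance, no notation, no axiom, no named fact, no `sorry`);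
kernel lane `--kind proof --supports stmt-HodgeConjecture-24833`.  Cell `pub/hodgecm-mathlib`, crux H413 (`stmt-HodgeConjecture-24833`), F0∕P3c line LH3 (closer stub `stub_N9`),
organ O-L1d′ `hCm` (central∕mixed corners), p08's J2-MIXED SPEC legs (M1) F0P3a-p05 ∕ **(M2) = this file** ∕ (M3) A-p12; the LOCAL (one factor `G_w`) twin of ★ p851016 §2 with
smooth PARAMETERS carried through, so that (M2) can be applied INSIDE the `Π_T G_w`-integral of (M1) at each face place, parametrically in everything else.  Author LH3-p04 (g4).

THE MATHEMATICS.  `G := U(α)_w`, `γ(c) := gprimeBlockAt α w S′ c` (the local chart, `w ∉ S′` a covered compact-chart place whose slots `{0,2}` carry opposite signs), face value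
`pw` (`e^{ipw_0} = e^{ipw_2} ≠ e^{ipw_1}`), `M := Z_G(γ(pw))`.  §1 is the LOCAL (M-UNFOLD): through the relabelling `e_τ : U(α∘τ)_w ≃ₜ* U(α)_w` and ★ (V9)
`M ≃ₜ* B × K`, `B = U(σ_w diag(α_{τ0}, α_{τ2}))(ℂ)`, `K = ker π_B` closed commutative inside the local chart torus `T = chartTorusGLoc α w S′` (= the range of the local chart,
★ `chartTorusGLoc_eq_range`), with the clauses [4] `g ∈ T ↔ π_B g` unit diagonal, [5] `π_B γ(c) = diag(e^{ic_0}, e^{ic_2})`, [6] `K`-component of `γ(c)` `= γ(0, c_1, 0)`,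
[7] `e(T ∩ M) = A × ⊤`, [8] `e⁻¹(b, 1) = e_τ(ι(b, 1))`, [10] — the one-place (M-UNFOLD) ★ p850499 with the place decomposition `archPiEquivCM` REMOVED.  §2: Harish-Chandra's
descent on `G` (generic ★ `integral_descConj_eq_integral_descConj_descended`) to `M`, compactness on a box around `pw` (★ `uniformlyProper_gprimeBlock_cpt_of_ne`, local
already), (B-STD) `φ : B ≃ₜ* U(J)`, ★ `exists_quotient_homeomorph_of_map_eq_prod_top`, ★ `exists_smul_map_mk_of_block_compact`, ★ `integral_descConj_eq_smul_integral_of_block`,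
ONE cut-off `β` on `M`, the passage group ↔ quotient by the COMPACT torus `T` (★ `quotientMeasure_eq_inv_smul_map_mk`), and the smooth ambient reading of the descended KERNEL
WITH PARAMETERS `Θ_M(π, A) = ∫_G β(y) Θ(π, ↑y A ↑y⁻¹) dν(y)` — jointly `C^∞` in `(π, A)` by the Hörmander engine ★ `contDiffAt_integral_comp_of_contDiff_of_support` — give
  **`∫_G Θ(π, ↑↑(g γ(c) g⁻¹)) dν_w = K • ∫_{U(J)} f((π, c), ↑↑(h · P diag(e^{ic_0}, e^{ic_2}) P⁻¹ · h⁻¹)) dμ₀(h)`** for `c` in a box around `pw` with distinct unit eigenvalues,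
`f((π, c), X) = χ(X) Θ_M(π, Λ(M₀⁻¹ X M₀) · ↑↑γ(0, c_1, 0))` jointly `C^∞`, ONE compact `X`-support, tangential in `c`.  Centre absorption (`diag(e^{iψ}, e^{−iψ})`, `ψ = (c_0 − c_2)∕2`)
is the consumer's ★ p851073 adapter, as for (B-desc).
HONEST LABEL: HC_CM is proved only modulo the 7 printed citations (2 remaining: hLiu418 = `stmt-HodgeConjecture-24832`, h413 = `stmt-HodgeConjecture-24833`) until rung 0 closes;
count-neutral assembly of ★ bricks.

## References
* [Rogawski1990] J. D. Rogawski, *Automorphic Representations of Unitary Groups in Three Variables*, Ann. of Math. Stud. 123 (1990), §4.12 Lemma 4.12.1 p. 66, §8.2 pp. 119–124.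
* [HarishChandra1970] Harish-Chandra (notes by G. van Dijk), *Harmonic Analysis on Reductive p-adic Groups*, LNM 162 (1970), Part I §3 Lemmas 22–23.
* [HormanderALPDO1] L. Hörmander, *The Analysis of Linear Partial Differential Operators I*, 2nd ed. (1990), Thm. 1.1.9 (differentiation under the integral).
* [Folland1995] G. B. Folland, *A Course in Abstract Harmonic Analysis* (1995), §2.6 Thm. 2.49, (2.52).
-/

set_option autoImplicit false

noncomputable section

open MeasureTheory MeasureTheory.Measure NumberField NumberField.InfinitePlace NumberField.mixedEmbedding Matrix Complex Set Filter Topology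
open scoped MatrixGroups Matrix Real Classical ENNReal NNReal ContDiff Matrix.Norms.Operator Pointwise
open Literature.NumberTheory.Automorphic Literature.NumberTheory.Automorphic.UnitaryGroup Literature.NumberTheory.Automorphic.ArchCartan
open Literature.NumberTheory.GaloisRepresentations Literature.MeasureTheory.Group Literature.LinearAlgebra.Matrix

namespace Literature.NumberTheory.Rogawski1990

/-! ## §1 The LOCAL (M-UNFOLD): `Z_{G_w}(γ_w(pw)) ≃ₜ* B × K`, explicit, with the torus clauses -/

section LocalUnfold

variable (L : Type) [Field L] [NumberField L] [IsCMField L] (α : Fin 3 → L)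
  (S' : Finset {w : InfinitePlace L // IsComplex w}) (w : {w : InfinitePlace L // IsComplex w}) (pw : Fin 3 → ℝ)

set_option maxHeartbeats 1600000 in
/-- **LOCAL (M-UNFOLD), explicit.**  `w ∉ S′`, face value `pw` (`e^{ipw_0} = e^{ipw_2} ≠ e^{ipw_1}`): a closed commutative `K ≤ Z_{G_w}(γ_w(pw))` inside the local chart torus
and `e : Z_{G_w}(γ_w(pw)) ≃ₜ* B × K` with [4] `g ∈ T ↔ (e g).1` unit diagonal, [5] `(e γ_w(c)).1 = diag(e^{ic_0}, e^{ic_2})`, [6] `↑(e γ_w(c)).2 = γ_w(0, c_1, 0)`, [7]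
`e(T ∩ M) = A × ⊤`, [8] `↑(e⁻¹(b, 1)) = e_τ(ι(b, 1))`, [10] `e k = (1, k)` on `K`. [cite: Rogawski1990, §8.2 p. 122; §4.12 p. 66] [cite: Knapp1986, Ch. V §3] -/
theorem exists_continuousMulEquiv_centralizer_gprimeBlockAt_explicit (hα : ∀ i, α i ≠ 0) (hS' : ∀ w, w ∈ S' → w ∈ splitChartPlaces L α)
    (hw : w ∉ S') (h02 : Circle.exp (pw 0) = Circle.exp (pw 2)) (h01 : Circle.exp (pw 0) ≠ Circle.exp (pw 1)) :
    ∃ (K : Subgroup ↥(Subgroup.centralizer ({gprimeBlockAt L α w S' pw} : Set ↥(archLocal L 3 (Matrix.diagonal α) w)))) (e : ↥(Subgroup.centralizer ({gprimeBlockAt L α w S' pw} : Set ↥(archLocal L 3 (Matrix.diagonal α) w))) ≃ₜ* ↥(unitaryGroupOfForm (starRingEnd ℂ) ((Matrix.diagonal ![α (lineOf (formSign L α w) 0), α (lineOf (formSign L α w) 2)]).map w.1.embedding)) × ↥K),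
      IsClosed (K : Set ↥(Subgroup.centralizer ({gprimeBlockAt L α w S' pw} : Set ↥(archLocal L 3 (Matrix.diagonal α) w)))) ∧
      (∀ k : ↥(Subgroup.centralizer ({gprimeBlockAt L α w S' pw} : Set ↥(archLocal L 3 (Matrix.diagonal α) w))), k ∈ K → (k : ↥(archLocal L 3 (Matrix.diagonal α) w)) ∈ chartTorusGLoc L α w S') ∧
      (∀ k₁, k₁ ∈ K → ∀ k₂, k₂ ∈ K → k₁ * k₂ = k₂ * k₁) ∧
      (∀ g : ↥(Subgroup.centralizer ({gprimeBlockAt L α w S' pw} : Set ↥(archLocal L 3 (Matrix.diagonal α) w))), (g : ↥(archLocal L 3 (Matrix.diagonal α) w)) ∈ chartTorusGLoc L α w S' ↔ (((e g).1 : ↥(unitaryGroupOfForm (starRingEnd ℂ) ((Matrix.diagonal ![α (lineOf (formSign L α w) 0), α (lineOf (formSign L α w) 2)]).map w.1.embedding))) : GL (Fin 2) ℂ) ∈ Set.range (circleDiagonal 2)) ∧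
      (∀ cw : Fin 3 → ℝ, (((e ⟨gprimeBlockAt L α w S' cw, chartTorusGLoc_le_centralizer L α w S' pw (gprimeBlockAt_mem_chartTorusGLoc L α w S' cw)⟩).1 : ↥(unitaryGroupOfForm (starRingEnd ℂ) ((Matrix.diagonal ![α (lineOf (formSign L α w) 0), α (lineOf (formSign L α w) 2)]).map w.1.embedding))) : GL (Fin 2) ℂ) =
        circleDiagonal 2 ![Circle.exp (cw 0), Circle.exp (cw 2)]) ∧
      (∀ cw : Fin 3 → ℝ, ((((e ⟨gprimeBlockAt L α w S' cw, chartTorusGLoc_le_centralizer L α w S' pw (gprimeBlockAt_mem_chartTorusGLoc L α w S' cw)⟩).2 : ↥K) : ↥(Subgroup.centralizer ({gprimeBlockAt L α w S' pw} : Set ↥(archLocal L 3 (Matrix.diagonal α) w)))) : ↥(archLocal L 3 (Matrix.diagonal α) w)) =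
        gprimeBlockAt L α w S' ![0, cw 1, 0]) ∧
      Subgroup.map (e : ↥(Subgroup.centralizer ({gprimeBlockAt L α w S' pw} : Set ↥(archLocal L 3 (Matrix.diagonal α) w))) →* ↥(unitaryGroupOfForm (starRingEnd ℂ) ((Matrix.diagonal ![α (lineOf (formSign L α w) 0), α (lineOf (formSign L α w) 2)]).map w.1.embedding)) × ↥K) ((chartTorusGLoc L α w S').subgroupOf (Subgroup.centralizer ({gprimeBlockAt L α w S' pw} : Set ↥(archLocal L 3 (Matrix.diagonal α) w)))) = ((((circleDiagonal 2).codRestrict (unitaryGroupOfForm (starRingEnd ℂ) ((Matrix.diagonal ![α (lineOf (formSign L α w) 0), α (lineOf (formSign L α w) 2)]).map w.1.embedding))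
            (circleDiagonal_mem_archLocal_diagonal L 2 ![α (lineOf (formSign L α w) 0), α (lineOf (formSign L α w) 2)] w)).range)).prod ⊤ ∧
      (∀ b : ↥(unitaryGroupOfForm (starRingEnd ℂ) ((Matrix.diagonal ![α (lineOf (formSign L α w) 0), α (lineOf (formSign L α w) 2)]).map w.1.embedding)), ((e.symm (b, 1) : ↥(Subgroup.centralizer ({gprimeBlockAt L α w S' pw} : Set ↥(archLocal L 3 (Matrix.diagonal α) w)))) : ↥(archLocal L 3 (Matrix.diagonal α) w)) =
          ((ContinuousMulEquiv.restrictSubgroup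
            (GLn.conjEquiv (Matrix.GeneralLinearGroup.mkOfDetNeZero _ (det_monomial_one_ne_zero 3 (lineOf (formSign L α w)))))
            (archLocal L 3 (Matrix.diagonal (α ∘ (lineOf (formSign L α w)))) w) (archLocal L 3 (Matrix.diagonal α) w)
            (mem_archLocal_comp_perm_iff_conj_mem L 3 α w (lineOf (formSign L α w))))
              ((endoEmb (starRingEnd ℂ) ((Matrix.diagonal ![(α ∘ (lineOf (formSign L α w))) 0, (α ∘ (lineOf (formSign L α w))) 2]).map w.1.embedding)
              ((Matrix.diagonal ![(α ∘ (lineOf (formSign L α w))) 1]).map w.1.embedding) ((Matrix.diagonal (α ∘ (lineOf (formSign L α w)))).map w.1.embedding)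
              (endoForm_archLocal_diagonal L (α ∘ (lineOf (formSign L α w))) w)) (b, 1)))) ∧
      (∀ k : ↥(Subgroup.centralizer ({gprimeBlockAt L α w S' pw} : Set ↥(archLocal L 3 (Matrix.diagonal α) w))), ∀ hk : k ∈ K, e k = (1, ⟨k, hk⟩)) := by
  classical
  -- §A  Notation: the relabelling at `w`, the standard wall point `diag z₀` in `G_w(α ∘ τ)`, the block embedding `ι`.
  let τ : Fin 3 ≃ Fin 3 := lineOf (formSign L α w)
  let G := ↥(archLocal L 3 (Matrix.diagonal α) w)
  let eτ : ↥(unitaryGroupOfForm (starRingEnd ℂ) ((Matrix.diagonal (α ∘ τ)).map w.1.embedding)) ≃ₜ* ↥(archLocal L 3 (Matrix.diagonal α) w) :=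
    ContinuousMulEquiv.restrictSubgroup (GLn.conjEquiv (Matrix.GeneralLinearGroup.mkOfDetNeZero _ (det_monomial_one_ne_zero 3 τ)))
      (archLocal L 3 (Matrix.diagonal (α ∘ τ)) w) (archLocal L 3 (Matrix.diagonal α) w) (mem_archLocal_comp_perm_iff_conj_mem L 3 α w τ)
  let z₀ : Fin 3 → Circle := fun k => Circle.exp (pw k)
  let d₀ : ↥(unitaryGroupOfForm (starRingEnd ℂ) ((Matrix.diagonal (α ∘ τ)).map w.1.embedding)) :=
    ⟨circleDiagonal 3 z₀, circleDiagonal_mem_archLocal_diagonal L 3 (α ∘ τ) w z₀⟩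
  let ι := endoEmb (starRingEnd ℂ) ((Matrix.diagonal ![(α ∘ τ) 0, (α ∘ τ) 2]).map w.1.embedding) ((Matrix.diagonal ![(α ∘ τ) 1]).map w.1.embedding)
      ((Matrix.diagonal (α ∘ τ)).map w.1.embedding) (endoForm_archLocal_diagonal L (α ∘ τ) w)
  let M' : Subgroup G := Subgroup.centralizer ({gprimeBlockAt L α w S' pw} : Set G)
  have hz02 : z₀ 0 = z₀ 2 := h02
  have hz01 : z₀ 0 ≠ z₀ 1 := h01
  obtain ⟨e9, he9⟩ := exists_centralizer_continuousMulEquiv_of_splitSingular L (α ∘ τ) w (z := z₀) hz02 hz01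
  -- the chart points, relabelled
  have hblk : ∀ cw : Fin 3 → ℝ,
      gprimeBlockAt L α w S' cw = eτ ⟨circleDiagonal 3 (fun k => Circle.exp (cw k)), circleDiagonal_mem_archLocal_diagonal L 3 (α ∘ τ) w _⟩ :=
    fun cw => by exact gprimeBlock_eq_relabel_circleDiagonal L α hw (fun _ => cw)
  have hwall : gprimeBlockAt L α w S' pw = eτ d₀ := hblk pw
  have hd₀ι : d₀ = ι (⟨circleDiagonal 2 ![z₀ 0, z₀ 2], (circleDiagonal_blocks_mem L (α ∘ τ) w z₀).1⟩, ⟨circleDiagonal 1 ![z₀ 1], (circleDiagonal_blocks_mem L (α ∘ τ) w z₀).2⟩) :=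
    circleDiagonal_eq_endoEmb L (α ∘ τ) w z₀
  -- §B  `ψ g = e_τ⁻¹ g` lands in `Z(d₀)`; the block projection `πM = e9 ∘ ψ′`.
  let ψ : ↥M' →* ↥(unitaryGroupOfForm (starRingEnd ℂ) ((Matrix.diagonal (α ∘ τ)).map w.1.embedding)) :=
    (eτ.symm : ↥(archLocal L 3 (Matrix.diagonal α) w) →* ↥(unitaryGroupOfForm (starRingEnd ℂ) ((Matrix.diagonal (α ∘ τ)).map w.1.embedding))).comp M'.subtype
  have hψ_apply : ∀ g : ↥M', ψ g = eτ.symm (g : G) := fun g => rfl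
  have hψ_mem : ∀ g : ↥M', ψ g ∈ Subgroup.centralizer ({d₀} : Set ↥(unitaryGroupOfForm (starRingEnd ℂ) ((Matrix.diagonal (α ∘ τ)).map w.1.embedding))) := by
    intro g
    rw [Subgroup.mem_centralizer_singleton_iff, hψ_apply]
    have hg : (g : G) * gprimeBlockAt L α w S' pw = gprimeBlockAt L α w S' pw * g := (Subgroup.mem_centralizer_singleton_iff.1 g.2)
    rw [hwall] at hg
    have h := congrArg eτ.symm hg
    simpa only [map_mul, ContinuousMulEquiv.symm_apply_apply] using h
  let ψ' : ↥M' →* ↥(Subgroup.centralizer ({d₀} : Set ↥(unitaryGroupOfForm (starRingEnd ℂ) ((Matrix.diagonal (α ∘ τ)).map w.1.embedding)))) :=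
    ψ.codRestrict _ hψ_mem
  let πM : ↥M' →* ↥(unitaryGroupOfForm (starRingEnd ℂ) ((Matrix.diagonal ![(α ∘ τ) 0, (α ∘ τ) 2]).map w.1.embedding)) × ↥(unitaryGroupOfForm (starRingEnd ℂ) ((Matrix.diagonal ![(α ∘ τ) 1]).map w.1.embedding)) := (e9 : _ →* _).comp ψ'
  let πB := (MonoidHom.fst _ _).comp πM
  have hπB_apply : ∀ g : ↥M', πB g = (πM g).1 := fun _ => rfl
  have hιπ : ∀ g : ↥M', ι (πM g) = ψ g := by
    intro g
    have h1 : ((e9.symm (πM g) : ↥(Subgroup.centralizer ({d₀} : Set _))) : ↥(unitaryGroupOfForm (starRingEnd ℂ) ((Matrix.diagonal (α ∘ τ)).map w.1.embedding))) = ι (πM g) :=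
      he9 (πM g)
    rw [← h1]
    show ((e9.symm (e9 (ψ' g)) : ↥(Subgroup.centralizer ({d₀} : Set _))) : _) = ψ g
    rw [ContinuousMulEquiv.symm_apply_apply]
    rfl
  have hcomp : ∀ g : ↥M', (g : G) = eτ (ι (πM g)) := by
    intro g
    rw [hιπ, hψ_apply, ContinuousMulEquiv.apply_symm_apply]
  -- §C  The block embedding `s_B : B →* M′`.
  let j : ↥(unitaryGroupOfForm (starRingEnd ℂ) ((Matrix.diagonal ![(α ∘ τ) 0, (α ∘ τ) 2]).map w.1.embedding)) →* G :=
    (eτ : ↥(unitaryGroupOfForm (starRingEnd ℂ) ((Matrix.diagonal (α ∘ τ)).map w.1.embedding)) →* ↥(archLocal L 3 (Matrix.diagonal α) w)).comp (ι.comp (MonoidHom.inl _ _))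
  have hj_apply : ∀ b, j b = eτ (ι (b, 1)) := fun _ => rfl
  have hb_comm : ∀ b : ↥(unitaryGroupOfForm (starRingEnd ℂ) ((Matrix.diagonal ![(α ∘ τ) 0, (α ∘ τ) 2]).map w.1.embedding)), ι (b, 1) * d₀ = d₀ * ι (b, 1) := by
    intro b
    rw [hd₀ι, ← map_mul, ← map_mul, Prod.mk_mul_mk, Prod.mk_mul_mk, one_mul, mul_one]
    congr 2
    apply Subtype.ext
    exact circleDiagonal_two_comm_of_eq (u := ![z₀ 0, z₀ 2]) (by exact hz02) (b : GL (Fin 2) ℂ)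
  have hj_mem : ∀ b, j b ∈ M' := by
    intro b
    rw [Subgroup.mem_centralizer_singleton_iff, hj_apply, hwall, ← map_mul, ← map_mul, hb_comm]
  let sB : ↥(unitaryGroupOfForm (starRingEnd ℂ) ((Matrix.diagonal ![(α ∘ τ) 0, (α ∘ τ) 2]).map w.1.embedding)) →* ↥M' := j.codRestrict M' hj_mem
  have hsB_coe : ∀ b, ((sB b : ↥M') : G) = j b := fun b => rfl
  have hπsB : ∀ b, πM (sB b) = (b, 1) := by
    intro b
    apply e9.symm.injective
    apply Subtype.ext
    rw [he9 (b, 1)]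
    show ((e9.symm (e9 (ψ' (sB b))) : ↥(Subgroup.centralizer ({d₀} : Set _))) : _) = ι (b, 1)
    rw [ContinuousMulEquiv.symm_apply_apply]
    show ψ (sB b) = ι (b, 1)
    rw [hψ_apply, hsB_coe, hj_apply, ContinuousMulEquiv.symm_apply_apply]
  have hπBsB : ∀ b, πB (sB b) = b := by
    intro b; rw [hπB_apply, hπsB]
  -- §D  `s_B(b)` commutes with `ker π_B`.
  have hcommK : ∀ b, ∀ k : ↥M', πB k = 1 → sB b * k = k * sB b := by
    intro b k hk
    apply Subtype.ext
    show ((sB b : ↥M') : G) * (k : G) = (k : G) * ((sB b : ↥M') : G)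
    rw [hsB_coe, hj_apply, hcomp k]
    have hk' : πM k = (1, (πM k).2) := Prod.ext (by rw [← hπB_apply]; exact hk) rfl
    have hc := (commute_endoEmb_inl_inr (starRingEnd ℂ) (endoForm_archLocal_diagonal L (α ∘ τ) w) b (πM k).2).eq
    rw [hk', ← map_mul eτ, ← map_mul eτ, hc]
  -- §E  `K = ker π_B` and `e_M : M′ ≃ₜ* B × K`.
  let K : Subgroup ↥M' := πB.ker
  have hK_mem : ∀ k : ↥M', k ∈ K ↔ πB k = 1 := fun k => MonoidHom.mem_ker
  have hsec : ∀ g : ↥M', (sB (πB g))⁻¹ * g ∈ K := by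
    intro g; rw [hK_mem, map_mul, map_inv, hπBsB, inv_mul_cancel]
  have hπB_cont : Continuous πB := by
    have h1 : Continuous ψ := by
      show Continuous fun g : ↥M' => eτ.symm (g : G)
      exact eτ.symm.continuous.comp continuous_subtype_val
    have h2 : Continuous ψ' := h1.subtype_mk _
    exact continuous_fst.comp (e9.continuous.comp h2)
  have hsB_cont : Continuous sB := by
    have h1 : Continuous j := by
      show Continuous fun b => eτ (ι (b, 1))
      exact eτ.continuous.comp ((continuous_endoEmb (starRingEnd ℂ) (endoForm_archLocal_diagonal L (α ∘ τ) w)).comp (continuous_id.prodMk continuous_const))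
    exact h1.subtype_mk _
  let eM : ↥M' ≃* (↥(unitaryGroupOfForm (starRingEnd ℂ) ((Matrix.diagonal ![(α ∘ τ) 0, (α ∘ τ) 2]).map w.1.embedding)) × ↥K) :=
    { toFun := fun g => (πB g, ⟨(sB (πB g))⁻¹ * g, hsec g⟩)
      invFun := fun q => sB q.1 * (q.2 : ↥M')
      left_inv := fun g => mul_inv_cancel_left _ _
      right_inv := fun q => by
        have h1 : πB (sB q.1 * (q.2 : ↥M')) = q.1 := by rw [map_mul, hπBsB, (hK_mem _).1 q.2.2, mul_one]
        refine Prod.ext h1 (Subtype.ext ?_)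
        show (sB (πB (sB q.1 * (q.2 : ↥M'))))⁻¹ * (sB q.1 * (q.2 : ↥M')) = (q.2 : ↥M')
        rw [h1, inv_mul_cancel_left]
      map_mul' := fun g h => by
        refine Prod.ext (map_mul πB g h) (Subtype.ext ?_)
        show (sB (πB (g * h)))⁻¹ * (g * h) = ((sB (πB g))⁻¹ * g) * ((sB (πB h))⁻¹ * h)
        have hc : sB (πB h) * ((sB (πB g))⁻¹ * g) = ((sB (πB g))⁻¹ * g) * sB (πB h) := hcommK (πB h) _ ((hK_mem _).1 (hsec g))
        have hc' : (sB (πB h))⁻¹ * ((sB (πB g))⁻¹ * g) = ((sB (πB g))⁻¹ * g) * (sB (πB h))⁻¹ := by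
          rw [inv_mul_eq_iff_eq_mul, ← mul_assoc, hc, mul_inv_cancel_right]
        rw [map_mul, map_mul, _root_.mul_inv_rev]
        calc (sB (πB h))⁻¹ * (sB (πB g))⁻¹ * (g * h)
            = ((sB (πB h))⁻¹ * ((sB (πB g))⁻¹ * g)) * h := by simp only [mul_assoc]
          _ = (((sB (πB g))⁻¹ * g) * (sB (πB h))⁻¹) * h := by rw [hc']
          _ = (sB (πB g))⁻¹ * g * ((sB (πB h))⁻¹ * h) := by simp only [mul_assoc] }
  have heM_cont : Continuous eM := by
    show Continuous fun g : ↥M' => (πB g, (⟨(sB (πB g))⁻¹ * g, hsec g⟩ : ↥K))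
    exact hπB_cont.prodMk (((hsB_cont.comp hπB_cont).inv.mul continuous_id).subtype_mk _)
  have heM_symm_cont : Continuous eM.symm := by
    show Continuous fun q : ↥(unitaryGroupOfForm (starRingEnd ℂ) ((Matrix.diagonal ![(α ∘ τ) 0, (α ∘ τ) 2]).map w.1.embedding)) × ↥K => sB q.1 * (q.2 : ↥M')
    exact (hsB_cont.comp continuous_fst).mul (continuous_subtype_val.comp continuous_snd)
  let e : ↥M' ≃ₜ* (↥(unitaryGroupOfForm (starRingEnd ℂ) ((Matrix.diagonal ![(α ∘ τ) 0, (α ∘ τ) 2]).map w.1.embedding)) × ↥K) := { eM with continuous_toFun := heM_cont, continuous_invFun := heM_symm_cont }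
  -- §F  Torus bookkeeping (the local chart torus IS the range of the local chart, ★ `mem_chartTorusGLoc_iff`).
  have htorus : ∀ cw : Fin 3 → ℝ, πM ⟨gprimeBlockAt L α w S' cw, chartTorusGLoc_le_centralizer L α w S' pw (gprimeBlockAt_mem_chartTorusGLoc L α w S' cw)⟩ =
      (⟨circleDiagonal 2 ![Circle.exp (cw 0), Circle.exp (cw 2)], (circleDiagonal_blocks_mem L (α ∘ τ) w (fun k => Circle.exp (cw k))).1⟩,
       ⟨circleDiagonal 1 ![Circle.exp (cw 1)], (circleDiagonal_blocks_mem L (α ∘ τ) w (fun k => Circle.exp (cw k))).2⟩) := by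
    intro cw
    apply e9.symm.injective
    apply Subtype.ext
    rw [he9, he9, hιπ, hψ_apply, ← circleDiagonal_eq_endoEmb L (α ∘ τ) w (fun k => Circle.exp (cw k))]
    show eτ.symm (gprimeBlockAt L α w S' cw) = _
    rw [hblk cw]
    exact ContinuousMulEquiv.symm_apply_apply eτ _
  -- a relabelled unit diagonal is a local chart point
  have mem_T_of_eq : ∀ (x : G) (cw : Fin 3 → ℝ),
      x = eτ ⟨circleDiagonal 3 (fun k => Circle.exp (cw k)), circleDiagonal_mem_archLocal_diagonal L 3 (α ∘ τ) w _⟩ → x ∈ chartTorusGLoc L α w S' := by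
    intro x cw hx
    rw [hx, ← hblk cw]
    exact gprimeBlockAt_mem_chartTorusGLoc L α w S' cw
  -- elements of `K` are chart points `γ(0, θ, 0)`
  have hKval : ∀ k : ↥M', πB k = 1 → ∃ θ : ℝ, (k : G) = gprimeBlockAt L α w S' ![0, θ, 0] := by
    intro k hk1
    obtain ⟨θ, hθ⟩ := exists_coe_eq_circleDiagonal_one_of_mem L (a := (α ∘ τ) 1) (hα _) w (πM k).2
    refine ⟨θ, ?_⟩
    have hk' : πM k = (1, (πM k).2) := Prod.ext (by rw [← hπB_apply]; exact hk1) rfl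
    have hz : ι (1, (πM k).2) =
        ⟨circleDiagonal 3 (fun i => Circle.exp ((![0, θ, 0] : Fin 3 → ℝ) i)), circleDiagonal_mem_archLocal_diagonal L 3 (α ∘ τ) w _⟩ := by
      rw [circleDiagonal_eq_endoEmb L (α ∘ τ) w (fun i => Circle.exp ((![0, θ, 0] : Fin 3 → ℝ) i))]
      congr 1
      refine Prod.ext (Subtype.ext ?_) (Subtype.ext ?_)
      · show ((1 : ↥(unitaryGroupOfForm (starRingEnd ℂ) ((Matrix.diagonal ![(α ∘ τ) 0, (α ∘ τ) 2]).map w.1.embedding))) : GL (Fin 2) ℂ) =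
          circleDiagonal 2 ![Circle.exp ((![0, θ, 0] : Fin 3 → ℝ) 0), Circle.exp ((![0, θ, 0] : Fin 3 → ℝ) 2)]
        have h0 : (![0, θ, 0] : Fin 3 → ℝ) 0 = 0 := rfl
        have h2 : (![0, θ, 0] : Fin 3 → ℝ) 2 = 0 := rfl
        rw [h0, h2, Circle.exp_zero]
        have h11 : (![(1 : Circle), 1] : Fin 2 → Circle) = 1 := by funext i; fin_cases i <;> rfl
        rw [h11, map_one]
        rfl
      · show (((πM k).2 : ↥(unitaryGroupOfForm (starRingEnd ℂ) ((Matrix.diagonal ![(α ∘ τ) 1]).map w.1.embedding))) : GL (Fin 1) ℂ) = circleDiagonal 1 ![Circle.exp ((![0, θ, 0] : Fin 3 → ℝ) 1)]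
        apply Units.ext
        rw [hθ, coe_circleDiagonal]
        ext i j
        fin_cases i; fin_cases j
        simp [Circle.coe_exp]
    rw [hcomp k, hk', hz, hblk]
  have hKT : ∀ k : ↥M', k ∈ K → (k : G) ∈ chartTorusGLoc L α w S' := by
    intro k hk
    obtain ⟨θ, hθ⟩ := hKval k ((hK_mem k).1 hk)
    rw [hθ]
    exact gprimeBlockAt_mem_chartTorusGLoc L α w S' _
  -- `s_B` of a unit diagonal is a chart point `γ(θ₀, 0, θ₁)`
  have hsT : ∀ (b : ↥(unitaryGroupOfForm (starRingEnd ℂ) ((Matrix.diagonal ![(α ∘ τ) 0, (α ∘ τ) 2]).map w.1.embedding))) (u : Fin 2 → Circle), circleDiagonal 2 u = (b : GL (Fin 2) ℂ) → ((sB b : ↥M') : G) ∈ chartTorusGLoc L α w S' := by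
    intro b u hu
    obtain ⟨θ₀, hθ₀⟩ := Circle.exp_surjective (u 0)
    obtain ⟨θ₁, hθ₁⟩ := Circle.exp_surjective (u 1)
    have hz : ι (b, 1) =
        ⟨circleDiagonal 3 (fun i => Circle.exp ((![θ₀, 0, θ₁] : Fin 3 → ℝ) i)), circleDiagonal_mem_archLocal_diagonal L 3 (α ∘ τ) w _⟩ := by
      rw [circleDiagonal_eq_endoEmb L (α ∘ τ) w (fun i => Circle.exp ((![θ₀, 0, θ₁] : Fin 3 → ℝ) i))]
      congr 1
      refine Prod.ext (Subtype.ext ?_) (Subtype.ext ?_)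
      · show ((b : ↥(unitaryGroupOfForm (starRingEnd ℂ) ((Matrix.diagonal ![(α ∘ τ) 0, (α ∘ τ) 2]).map w.1.embedding))) : GL (Fin 2) ℂ) =
          circleDiagonal 2 ![Circle.exp ((![θ₀, 0, θ₁] : Fin 3 → ℝ) 0), Circle.exp ((![θ₀, 0, θ₁] : Fin 3 → ℝ) 2)]
        rw [← hu]
        have h0 : (![θ₀, 0, θ₁] : Fin 3 → ℝ) 0 = θ₀ := rfl
        have h2 : (![θ₀, 0, θ₁] : Fin 3 → ℝ) 2 = θ₁ := rfl
        rw [h0, h2, hθ₀, hθ₁]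
        congr 1
        funext i; fin_cases i <;> rfl
      · show ((1 : ↥(unitaryGroupOfForm (starRingEnd ℂ) ((Matrix.diagonal ![(α ∘ τ) 1]).map w.1.embedding))) : GL (Fin 1) ℂ) = circleDiagonal 1 ![Circle.exp ((![θ₀, 0, θ₁] : Fin 3 → ℝ) 1)]
        have h1 : (![θ₀, 0, θ₁] : Fin 3 → ℝ) 1 = 0 := rfl
        rw [h1, Circle.exp_zero]
        have h11 : (![(1 : Circle)] : Fin 1 → Circle) = 1 := by funext i; fin_cases i; rfl
        rw [h11, map_one]
        rfl
    exact mem_T_of_eq _ (![θ₀, 0, θ₁]) (by rw [hsB_coe, hj_apply, hz])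
  -- [4] the chart torus read through `π_B`
  have hiff : ∀ g : ↥M', (g : G) ∈ chartTorusGLoc L α w S' ↔ ((πB g : ↥(unitaryGroupOfForm (starRingEnd ℂ) ((Matrix.diagonal ![(α ∘ τ) 0, (α ∘ τ) 2]).map w.1.embedding))) : GL (Fin 2) ℂ) ∈ Set.range (circleDiagonal 2) := by
    intro g
    constructor
    · intro hg
      obtain ⟨cw, hcw⟩ := (mem_chartTorusGLoc_iff L α w S' hα hS' (g : G)).1 hg
      have hg' : g = ⟨gprimeBlockAt L α w S' cw, chartTorusGLoc_le_centralizer L α w S' pw (gprimeBlockAt_mem_chartTorusGLoc L α w S' cw)⟩ := Subtype.ext hcw.symm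
      refine ⟨![Circle.exp (cw 0), Circle.exp (cw 2)], ?_⟩
      rw [hg', hπB_apply, htorus]
    · rintro ⟨u, hu⟩
      have hg : (g : G) = ((sB (πB g) : ↥M') : G) * (((sB (πB g))⁻¹ * g : ↥M') : G) := by
        rw [← Subgroup.coe_mul, mul_inv_cancel_left]
      rw [hg]
      exact Subgroup.mul_mem _ (hsT (πB g) u hu) (hKT _ (hsec g))
  -- [6] the `K`-component of a chart point: zero the block slots
  have hsnd : ∀ cw : Fin 3 → ℝ,
      (((sB (πB ⟨gprimeBlockAt L α w S' cw, chartTorusGLoc_le_centralizer L α w S' pw (gprimeBlockAt_mem_chartTorusGLoc L α w S' cw)⟩))⁻¹ * ⟨gprimeBlockAt L α w S' cw, chartTorusGLoc_le_centralizer L α w S' pw (gprimeBlockAt_mem_chartTorusGLoc L α w S' cw)⟩ : ↥M') : G) =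
        gprimeBlockAt L α w S' ![0, cw 1, 0] := by
    intro cw
    have hmem' : gprimeBlockAt L α w S' ![0, cw 1, 0] ∈ M' := chartTorusGLoc_le_centralizer L α w S' pw (gprimeBlockAt_mem_chartTorusGLoc L α w S' ![0, cw 1, 0])
    have hprod : (⟨gprimeBlockAt L α w S' cw, chartTorusGLoc_le_centralizer L α w S' pw (gprimeBlockAt_mem_chartTorusGLoc L α w S' cw)⟩ : ↥M') = sB (πB ⟨gprimeBlockAt L α w S' cw, chartTorusGLoc_le_centralizer L α w S' pw (gprimeBlockAt_mem_chartTorusGLoc L α w S' cw)⟩) * ⟨_, hmem'⟩ := by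
      apply Subtype.ext
      show gprimeBlockAt L α w S' cw = j (πB ⟨gprimeBlockAt L α w S' cw, _⟩) * gprimeBlockAt L α w S' ![0, cw 1, 0]
      rw [hj_apply, hπB_apply, htorus, hblk cw, hblk ![0, cw 1, 0], ← map_mul eτ]
      congr 1
      rw [circleDiagonal_eq_endoEmb L (α ∘ τ) w (fun k => Circle.exp (cw k)),
        circleDiagonal_eq_endoEmb L (α ∘ τ) w (fun k => Circle.exp ((![0, cw 1, 0] : Fin 3 → ℝ) k)), ← map_mul ι]
      congr 1
      refine Prod.ext (Subtype.ext ?_) (Subtype.ext ?_)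
      · show circleDiagonal 2 ![Circle.exp (cw 0), Circle.exp (cw 2)] =
          circleDiagonal 2 ![Circle.exp (cw 0), Circle.exp (cw 2)] * circleDiagonal 2 ![Circle.exp ((![0, cw 1, 0] : Fin 3 → ℝ) 0), Circle.exp ((![0, cw 1, 0] : Fin 3 → ℝ) 2)]
        have h0 : (![0, cw 1, 0] : Fin 3 → ℝ) 0 = 0 := rfl
        have h2 : (![0, cw 1, 0] : Fin 3 → ℝ) 2 = 0 := rfl
        rw [h0, h2, Circle.exp_zero]
        have h11 : (![(1 : Circle), 1] : Fin 2 → Circle) = 1 := by funext i; fin_cases i <;> rfl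
        rw [h11, map_one, mul_one]
      · show circleDiagonal 1 ![Circle.exp (cw 1)] = 1 * circleDiagonal 1 ![Circle.exp ((![0, cw 1, 0] : Fin 3 → ℝ) 1)]
        rw [one_mul]
        rfl
    calc (((sB (πB ⟨gprimeBlockAt L α w S' cw, chartTorusGLoc_le_centralizer L α w S' pw (gprimeBlockAt_mem_chartTorusGLoc L α w S' cw)⟩))⁻¹ * ⟨gprimeBlockAt L α w S' cw, chartTorusGLoc_le_centralizer L α w S' pw (gprimeBlockAt_mem_chartTorusGLoc L α w S' cw)⟩ : ↥M') : G)
        = (((sB (πB ⟨gprimeBlockAt L α w S' cw, chartTorusGLoc_le_centralizer L α w S' pw (gprimeBlockAt_mem_chartTorusGLoc L α w S' cw)⟩))⁻¹ *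
            (sB (πB ⟨gprimeBlockAt L α w S' cw, chartTorusGLoc_le_centralizer L α w S' pw (gprimeBlockAt_mem_chartTorusGLoc L α w S' cw)⟩) * ⟨_, hmem'⟩) : ↥M') : G) := by rw [← hprod]
      _ = gprimeBlockAt L α w S' ![0, cw 1, 0] := by rw [inv_mul_cancel_left]
  -- §G  Assembly.
  refine ⟨K, e, ?_, hKT, ?_, hiff, ?_, hsnd, ?_, ?_, ?_⟩
  · show IsClosed ((πB.ker : Subgroup ↥M') : Set ↥M')
    rw [MonoidHom.coe_ker]
    exact isClosed_singleton.preimage hπB_cont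
  · intro k₁ hk₁ k₂ hk₂
    have h := chartTorusGLoc_mul_comm L α w S' ⟨(k₁ : G), hKT k₁ hk₁⟩ ⟨(k₂ : G), hKT k₂ hk₂⟩
    have h' : (k₁ : G) * (k₂ : G) = (k₂ : G) * (k₁ : G) := congrArg Subtype.val h
    exact Subtype.ext h'
  · intro cw
    show (((πM ⟨gprimeBlockAt L α w S' cw, chartTorusGLoc_le_centralizer L α w S' pw (gprimeBlockAt_mem_chartTorusGLoc L α w S' cw)⟩).1 : ↥(unitaryGroupOfForm (starRingEnd ℂ) ((Matrix.diagonal ![(α ∘ τ) 0, (α ∘ τ) 2]).map w.1.embedding))) : GL (Fin 2) ℂ) = circleDiagonal 2 ![Circle.exp (cw 0), Circle.exp (cw 2)]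
    rw [htorus]
  · ext q
    simp only [Subgroup.mem_map, Subgroup.mem_subgroupOf, Subgroup.mem_prod, Subgroup.mem_top, and_true, MonoidHom.mem_range,
      MonoidHom.coe_coe]
    constructor
    · rintro ⟨g, hg, rfl⟩
      obtain ⟨u, hu⟩ := (hiff g).1 hg
      exact ⟨u, Subtype.ext hu⟩
    · rintro ⟨u, hu⟩
      refine ⟨e.symm q, (hiff _).2 ⟨u, ?_⟩, e.apply_symm_apply q⟩
      have h1 : πB (e.symm q) = q.1 := by
        show (e (e.symm q)).1 = q.1
        rw [e.apply_symm_apply]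
      rw [h1, ← hu]
      rfl
  · intro b
    show (((sB b * ((1 : ↥K) : ↥M')) : ↥M') : G) = _
    rw [Subgroup.coe_one, mul_one, hsB_coe]
    show j b = eτ (ι (b, 1))
    rw [hj_apply]
  · intro k hk
    have hk1 : πB k = 1 := (hK_mem k).1 hk
    refine Prod.ext hk1 (Subtype.ext ?_)
    show (sB (πB k))⁻¹ * k = k
    rw [hk1, map_one, inv_one, one_mul]

end LocalUnfold

/-! ## §2 The parametric one-place box descent -/

section Descent

variable (L : Type) [Field L] [NumberField L] [IsCMField L] (α : Fin 3 → L)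

set_option maxHeartbeats 2400000 in
/-- **(M2) ONE-PLACE PARAMETRIC BOX DESCENT TO `U(J)`.**  House frame; `w ∉ S′` a covered compact-chart place (`S′` admissible), face value `pw` (`pw_0 = pw_2`, `e^{ipw_0} ≠ e^{ipw_1}`),
any Haar `ν_w` on `G_w = U(α)_w`, any Haar `μ₀` on `U(J)`; a SMOOTH FAMILY of test functions `Θ : P × M₃(ℂ) → ℂ` (finite-dimensional parameter space `P`), compactly supported in the
matrix variable uniformly in the parameter.  Then there are `K ≠ 0`, an open `U ∋ pw` and ONE jointly smooth `f : (P × coordinates) × M₂(ℂ) → ℂ`, compactly supported in the matrix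
variable uniformly (ONE compact `C′`), vanishing identically at every parameter where `Θ` does (clause (Z) of p08's DESC schema), tangential in the coordinate (depends on
`c_1` only), with, for every parameter `q` and every `c ∈ U` with distinct unit eigenvalues,
**`∫_{G_w} Θ(q, ↑↑(g · γ_w(c) · g⁻¹)) dν_w(g) = K · ∫_{U(J)} f((q, c), ↑↑(h · P diag(e^{ic_0}, e^{ic_2}) P⁻¹ · h⁻¹)) dμ₀(h)`**.
[cite: Rogawski1990, §4.12 Lemma 4.12.1 p. 66; §8.2 pp. 119–124] [cite: HarishChandra1970, Part I §3 Lemma 22] [cite: HormanderALPDO1, Thm. 1.1.9] [cite: Folland1995, §2.6 (2.52)] -/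
theorem exists_descent_box_localOrbitalIntegral_param (hα : ∀ i, α i ≠ 0)
    (hreal : ∀ (w : {w : InfinitePlace L // IsComplex w}) (i : Fin 3), (w.1.embedding (α i)).im = 0)
    {J : Matrix (Fin 2) (Fin 2) ℂ} (hJ : J = (StdForm.antidiagonal 2).over ℂ)
    [MeasurableSpace ↥(unitaryGroupOfForm (starRingEnd ℂ) J)] [BorelSpace ↥(unitaryGroupOfForm (starRingEnd ℂ) J)] [LocallyCompactSpace ↥(unitaryGroupOfForm (starRingEnd ℂ) J)] [SecondCountableTopology ↥(unitaryGroupOfForm (starRingEnd ℂ) J)]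
    (μ₀ : Measure ↥(unitaryGroupOfForm (starRingEnd ℂ) J)) [μ₀.IsHaarMeasure] [μ₀.IsMulRightInvariant]
    {S' : Finset {w : InfinitePlace L // IsComplex w}} {w : {w : InfinitePlace L // IsComplex w}} (hS' : ∀ w, w ∈ S' → w ∈ splitChartPlaces L α) (hw : w ∉ S') (hwsp : w ∈ splitChartPlaces L α)
    {pw : Fin 3 → ℝ} (h02 : pw 0 = pw 2) (h01 : Circle.exp (pw 0) ≠ Circle.exp (pw 1))
    [MeasurableSpace ↥(archLocal L 3 (Matrix.diagonal α) w)] [BorelSpace ↥(archLocal L 3 (Matrix.diagonal α) w)] (νw : Measure ↥(archLocal L 3 (Matrix.diagonal α) w)) [νw.IsHaarMeasure] [νw.IsMulRightInvariant]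
    {P : Type} [NormedAddCommGroup P] [NormedSpace ℝ P] [FiniteDimensional ℝ P]
    (Θ : P × Matrix (Fin 3) (Fin 3) ℂ → ℂ) (hΘ : ContDiff ℝ ∞ Θ) (hΘC : ∃ C : Set (Matrix (Fin 3) (Fin 3) ℂ), IsCompact C ∧ ∀ q X, X ∉ C → Θ (q, X) = 0) :
    ∃ (K : ℝ) (U : Set (Fin 3 → ℝ)) (f : (P × (Fin 3 → ℝ)) × Matrix (Fin 2) (Fin 2) ℂ → ℂ) (C' : Set (Matrix (Fin 2) (Fin 2) ℂ)),
      K ≠ 0 ∧ IsOpen U ∧ pw ∈ U ∧ ContDiff ℝ ∞ f ∧ IsCompact C' ∧ (∀ q X, X ∉ C' → f (q, X) = 0) ∧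
      (∀ q : P, (∀ X, Θ (q, X) = 0) → ∀ (cw : Fin 3 → ℝ) (X : Matrix (Fin 2) (Fin 2) ℂ), f ((q, cw), X) = 0) ∧
      (∀ (q : P) (cw : Fin 3 → ℝ) (X : Matrix (Fin 2) (Fin 2) ℂ), f ((q, cw), X) = f ((q, ![0, cw 1, 0]), X)) ∧
      ∀ (q : P), ∀ cw ∈ U, Function.Injective (fun i : Fin 3 => Circle.exp (cw i)) →
        ∫ g : ↥(archLocal L 3 (Matrix.diagonal α) w), Θ (q, (((g * gprimeBlockAt L α w S' cw * g⁻¹ : ↥(archLocal L 3 (Matrix.diagonal α) w)) : GL (Fin 3) ℂ) : Matrix (Fin 3) (Fin 3) ℂ)) ∂νw =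
          K • ∫ h : ↥(unitaryGroupOfForm (starRingEnd ℂ) J),
            f ((q, cw), (((h * ⟨Matrix.GeneralLinearGroup.mkOfDetNeZero !![(1 : ℂ), 1; 1, -1] det_cayleyTwo_ne_zero * circleDiagonal 2 ![Circle.exp (cw 0), Circle.exp (cw 2)] * (Matrix.GeneralLinearGroup.mkOfDetNeZero !![(1 : ℂ), 1; 1, -1] det_cayleyTwo_ne_zero)⁻¹,
              cayley_conj_circleDiagonal_mem_of_eq_over hJ _⟩ * h⁻¹ : ↥(unitaryGroupOfForm (starRingEnd ℂ) J)) : GL (Fin 2) ℂ) : Matrix (Fin 2) (Fin 2) ℂ)) ∂μ₀ := by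
  -- ### frame facts
  obtain ⟨hreal2, hsgn⟩ := blockWeights_of_mem_splitChartPlaces L α w hwsp
  have h02c : Circle.exp (pw 0) = Circle.exp (pw 2) := by rw [h02]
  have hw' : ¬ (w ∈ S' ∧ w ∈ splitChartPlaces L α) := fun h => hw h.1
  haveI : LocallyCompactSpace ↥(archLocal L 3 (Matrix.diagonal α) w) := locallyCompactSpace_archLocal_three L α w
  haveI : SecondCountableTopology ↥(archLocal L 3 (Matrix.diagonal α) w) := secondCountableTopology_archLocal_three L α w
  -- ### the LOCAL (M-UNFOLD) (§1)
  refine (exists_continuousMulEquiv_centralizer_gprimeBlockAt_explicit L α S' w pw hα hS' hw h02c h01).elim fun K hK => hK.elim fun e he => ?_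
  obtain ⟨hKc, hKsub, hKcomm, h4, h5, h6, hmapT, h8, h10⟩ := he
  -- ### (B-STD): `φ : B ≃ₜ* U(J)`; `e′ := (φ × id) ∘ e`
  obtain ⟨φ, hφ, hval⟩ := exists_continuousMulEquiv_diagonal_weights_std (L := L) w.1.embedding ![α (lineOf (formSign L α w) 0), α (lineOf (formSign L α w) 2)] hreal2 hsgn hJ
  let ψ : ↥(Subgroup.centralizer ({gprimeBlockAt L α w S' pw} : Set ↥(archLocal L 3 (Matrix.diagonal α) w))) ≃* ↥(unitaryGroupOfForm (starRingEnd ℂ) J) × ↥K := e.toMulEquiv.trans (MulEquiv.prodCongr φ.toMulEquiv (MulEquiv.refl ↥K))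
  have hψc : Continuous ψ := by
    show Continuous fun g => (φ (e g).1, (e g).2)
    exact (φ.continuous.comp (continuous_fst.comp e.continuous)).prodMk (continuous_snd.comp e.continuous)
  have hψsc : Continuous ψ.symm := by
    show Continuous fun q : ↥(unitaryGroupOfForm (starRingEnd ℂ) J) × ↥K => e.symm (φ.symm q.1, q.2)
    exact e.symm.continuous.comp ((φ.symm.continuous.comp continuous_fst).prodMk continuous_snd)
  let e' : ↥(Subgroup.centralizer ({gprimeBlockAt L α w S' pw} : Set ↥(archLocal L 3 (Matrix.diagonal α) w))) ≃ₜ* ↥(unitaryGroupOfForm (starRingEnd ℂ) J) × ↥K := { ψ with continuous_toFun := hψc, continuous_invFun := hψsc }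
  have he' : ∀ g, e' g = (φ (e g).1, (e g).2) := fun _ => rfl
  have he's : ∀ q, e'.symm q = e.symm (φ.symm q.1, q.2) := fun _ => rfl
  -- ### the local chart torus inside `M`; the block torus `A = φ(A_w)`
  have hT : chartTorusGLoc L α w S' ≤ Subgroup.centralizer ({gprimeBlockAt L α w S' pw} : Set ↥(archLocal L 3 (Matrix.diagonal α) w)) := chartTorusGLoc_le_centralizer L α w S' pw
  let A : Subgroup ↥(unitaryGroupOfForm (starRingEnd ℂ) J) := Subgroup.map (φ : ↥(unitaryGroupOfForm (starRingEnd ℂ) ((Matrix.diagonal ![α (lineOf (formSign L α w) 0), α (lineOf (formSign L α w) 2)]).map w.1.embedding)) →* ↥(unitaryGroupOfForm (starRingEnd ℂ) J)) (((circleDiagonal 2).codRestrict (unitaryGroupOfForm (starRingEnd ℂ) ((Matrix.diagonal ![α (lineOf (formSign L α w) 0), α (lineOf (formSign L α w) 2)]).map w.1.embedding))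
      (circleDiagonal_mem_archLocal_diagonal L 2 ![α (lineOf (formSign L α w) 0), α (lineOf (formSign L α w) 2)] w)).range)
  have hmemA : ∀ u : ↥(unitaryGroupOfForm (starRingEnd ℂ) J), u ∈ A ↔ ((φ.symm u : ↥(unitaryGroupOfForm (starRingEnd ℂ) ((Matrix.diagonal ![α (lineOf (formSign L α w) 0), α (lineOf (formSign L α w) 2)]).map w.1.embedding))) : GL (Fin 2) ℂ) ∈ Set.range (circleDiagonal 2) := by
    intro u
    simp only [A, Subgroup.mem_map, MonoidHom.mem_range, MonoidHom.coe_coe, MonoidHom.codRestrict_apply]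
    constructor
    · rintro ⟨b, ⟨v, rfl⟩, hb⟩
      refine ⟨v, ?_⟩
      rw [← hb, ContinuousMulEquiv.symm_apply_apply]
    · rintro ⟨v, hv⟩
      exact ⟨φ.symm u, ⟨v, Subtype.ext hv⟩, φ.apply_symm_apply _⟩
  have hTA' : ∀ g : ↥(Subgroup.centralizer ({gprimeBlockAt L α w S' pw} : Set ↥(archLocal L 3 (Matrix.diagonal α) w))), g ∈ (chartTorusGLoc L α w S').subgroupOf (Subgroup.centralizer ({gprimeBlockAt L α w S' pw} : Set ↥(archLocal L 3 (Matrix.diagonal α) w))) ↔ (e' g).1 ∈ A := by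
    intro g
    rw [Subgroup.mem_subgroupOf, h4 g, hmemA, he']
    simp only [ContinuousMulEquiv.symm_apply_apply]
  have hmapT' : Subgroup.map (e' : ↥(Subgroup.centralizer ({gprimeBlockAt L α w S' pw} : Set ↥(archLocal L 3 (Matrix.diagonal α) w))) →* ↥(unitaryGroupOfForm (starRingEnd ℂ) J) × ↥K) ((chartTorusGLoc L α w S').subgroupOf (Subgroup.centralizer ({gprimeBlockAt L α w S' pw} : Set ↥(archLocal L 3 (Matrix.diagonal α) w)))) = A.prod ⊤ := by
    ext q
    simp only [Subgroup.mem_map, Subgroup.mem_prod, Subgroup.mem_top, and_true, MonoidHom.coe_coe]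
    constructor
    · rintro ⟨g, hg, rfl⟩
      exact (hTA' g).1 hg
    · intro hq
      refine ⟨e'.symm q, (hTA' _).2 ?_, e'.apply_symm_apply q⟩
      rw [e'.apply_symm_apply]
      exact hq
  -- ### instances
  have hMc : IsClosed ((Subgroup.centralizer ({gprimeBlockAt L α w S' pw} : Set ↥(archLocal L 3 (Matrix.diagonal α) w))) : Set ↥(archLocal L 3 (Matrix.diagonal α) w)) := Set.isClosed_centralizer _
  haveI : LocallyCompactSpace ↥(Subgroup.centralizer ({gprimeBlockAt L α w S' pw} : Set ↥(archLocal L 3 (Matrix.diagonal α) w))) := hMc.isClosedEmbedding_subtypeVal.locallyCompactSpace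
  haveI : SecondCountableTopology ↥(Subgroup.centralizer ({gprimeBlockAt L α w S' pw} : Set ↥(archLocal L 3 (Matrix.diagonal α) w))) := TopologicalSpace.Subtype.secondCountableTopology _
  letI : MeasurableSpace (↥(Subgroup.centralizer ({gprimeBlockAt L α w S' pw} : Set ↥(archLocal L 3 (Matrix.diagonal α) w))) ⧸ (chartTorusGLoc L α w S').subgroupOf (Subgroup.centralizer ({gprimeBlockAt L α w S' pw} : Set ↥(archLocal L 3 (Matrix.diagonal α) w)))) := borel _
  haveI : BorelSpace (↥(Subgroup.centralizer ({gprimeBlockAt L α w S' pw} : Set ↥(archLocal L 3 (Matrix.diagonal α) w))) ⧸ (chartTorusGLoc L α w S').subgroupOf (Subgroup.centralizer ({gprimeBlockAt L α w S' pw} : Set ↥(archLocal L 3 (Matrix.diagonal α) w)))) := ⟨rfl⟩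
  haveI : LocallyCompactSpace ↥K := hKc.isClosedEmbedding_subtypeVal.locallyCompactSpace
  haveI : SecondCountableTopology ↥K := TopologicalSpace.Subtype.secondCountableTopology _
  letI : MeasurableSpace ↥K := borel _
  haveI : BorelSpace ↥K := ⟨rfl⟩
  letI : MeasurableSpace (↥(unitaryGroupOfForm (starRingEnd ℂ) J) ⧸ A) := borel _
  haveI : BorelSpace (↥(unitaryGroupOfForm (starRingEnd ℂ) J) ⧸ A) := ⟨rfl⟩
  haveI : CompactSpace ↥A := isCompact_iff_compactSpace.mp (isCompact_map_circleDiagonal_range L α w φ)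
  have hA : IsClosed ((A : Subgroup ↥(unitaryGroupOfForm (starRingEnd ℂ) J)) : Set ↥(unitaryGroupOfForm (starRingEnd ℂ) J)) := (isCompact_map_circleDiagonal_range L α w φ).isClosed
  have hcommB : ∀ x y : ↥(unitaryGroupOfForm (starRingEnd ℂ) ((Matrix.diagonal ![α (lineOf (formSign L α w) 0), α (lineOf (formSign L α w) 2)]).map w.1.embedding)), (x : GL (Fin 2) ℂ) ∈ Set.range (circleDiagonal 2) → (y : GL (Fin 2) ℂ) ∈ Set.range (circleDiagonal 2) → x * y = y * x := by
    rintro x y ⟨u, hu⟩ ⟨v, hv⟩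
    apply Subtype.ext
    show (x : GL (Fin 2) ℂ) * y = y * x
    rw [← hu, ← hv, ← map_mul, ← map_mul, mul_comm]
  have hAcomm : ∀ a b : ↥A, a * b = b * a := by
    intro a b
    have ha := (hmemA a.1).1 a.2
    have hb := (hmemA b.1).1 b.2
    apply Subtype.ext
    apply φ.symm.injective
    show φ.symm ((a : ↥(unitaryGroupOfForm (starRingEnd ℂ) J)) * (b : ↥(unitaryGroupOfForm (starRingEnd ℂ) J))) = φ.symm ((b : ↥(unitaryGroupOfForm (starRingEnd ℂ) J)) * (a : ↥(unitaryGroupOfForm (starRingEnd ℂ) J)))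
    rw [map_mul, map_mul]; exact hcommB _ _ ha hb
  -- the local chart torus: compact, commutative; a Haar measure on it (inversion invariant)
  haveI : CompactSpace ↥(chartTorusGLoc L α w S') := compactSpace_chartTorusGLoc_of_not_mem L α w S' hα hS' hw
  haveI : LocallyCompactSpace ↥(chartTorusGLoc L α w S') := locallyCompactSpace_chartTorusGLoc L α w S'
  letI : CommGroup ↥(chartTorusGLoc L α w S') := { (inferInstance : Group _) with mul_comm := chartTorusGLoc_mul_comm L α w S' }
  let tT : Measure ↥(chartTorusGLoc L α w S') := haarMeasure (Classical.arbitrary (TopologicalSpace.PositiveCompacts _))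
  haveI : tT.IsInvInvariant := IsHaarMeasure.isInvInvariant_of_regular tT
  haveI : tT.IsMulRightInvariant := isMulRightInvariant_of_isInvInvariant tT
  haveI := isHaarMeasure_map_subgroupOfEquivOfLe_symm hT tT
  haveI := isInvInvariant_map_subgroupOfEquivOfLe_symm hT tT
  have hTc := isClosed_subgroupOf_of_isClosed _ (Subgroup.centralizer ({gprimeBlockAt L α w S' pw} : Set ↥(archLocal L 3 (Matrix.diagonal α) w))) (isClosed_chartTorusGLoc L α w S')
  -- ### `Ψ : M ⧸ T′ ≃ₜ U(J) ⧸ A`, a Haar measure `νM` on `M` (right and inversion invariant), the descent scalar `κ`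
  obtain ⟨Ψ, -, hΨ⟩ := exists_quotient_homeomorph_of_map_eq_prod_top ((chartTorusGLoc L α w S').subgroupOf (Subgroup.centralizer ({gprimeBlockAt L α w S' pw} : Set ↥(archLocal L 3 (Matrix.diagonal α) w)))) A e' hmapT'
  obtain ⟨νM, hνM1, hνM2, hνM3⟩ := exists_isHaarMeasure_isMulRightInvariant_isInvInvariant_of_continuousMulEquiv_prod e'
    (fun x y => Subtype.ext (hKcomm _ x.2 _ y.2)) μ₀
  haveI := hνM1; haveI := hνM2; haveI := hνM3
  letI : CommGroup ↥K := { (inferInstance : Group ↥K) with mul_comm := fun a b => Subtype.ext (hKcomm _ a.2 _ b.2) }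
  let νK : Measure ↥K := haarMeasure (Classical.arbitrary (TopologicalSpace.PositiveCompacts ↥K))
  haveI : νK.IsInvInvariant := IsHaarMeasure.isInvInvariant_of_regular νK
  haveI : νK.IsMulRightInvariant := isMulRightInvariant_of_isInvInvariant νK
  letI : CommGroup ↥A := { (inferInstance : Group ↥A) with mul_comm := hAcomm }
  let ρA : Measure ↥A := haarMeasure (Classical.arbitrary (TopologicalSpace.PositiveCompacts _))
  haveI : ρA.IsInvInvariant := IsHaarMeasure.isInvInvariant_of_regular ρA
  obtain ⟨κ, hκ, hmap, -⟩ := exists_smul_map_mk_of_block_compact e' ((chartTorusGLoc L α w S').subgroupOf _) hTc A hA hTA' Ψ hΨ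
    (Measure.map (Subgroup.subgroupOfEquivOfLe hT).symm tT) νM ρA μ₀ νK
  -- ### Harish-Chandra's compactness on a box around `pw` (★ `uniformlyProper_gprimeBlock_cpt_of_ne`), uniform in the parameter through the common matrix support
  obtain ⟨CΘ, hCΘ, hΘ0⟩ := hΘC
  have hdet : ((Matrix.diagonal α).map w.1.embedding).det ≠ 0 := by
    rw [Matrix.diagonal_map (map_zero _), Matrix.det_diagonal]
    exact Finset.prod_ne_zero_iff.2 fun i _ => (map_ne_zero _).2 (hα i)
  have hce := isClosedEmbedding_coe_unitaryGroupOfForm ((Matrix.diagonal α).map w.1.embedding) hdet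
  have hCG : IsCompact {g : ↥(archLocal L 3 (Matrix.diagonal α) w) | ((g : GL (Fin 3) ℂ) : Matrix (Fin 3) (Fin 3) ℂ) ∈ CΘ} := hce.isCompact_preimage hCΘ
  have hsuppΘ : ∀ q : P, tsupport (fun g : ↥(archLocal L 3 (Matrix.diagonal α) w) => Θ (q, ((g : GL (Fin 3) ℂ) : Matrix (Fin 3) (Fin 3) ℂ))) ⊆ {g : ↥(archLocal L 3 (Matrix.diagonal α) w) | ((g : GL (Fin 3) ℂ) : Matrix (Fin 3) (Fin 3) ℂ) ∈ CΘ} := by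
    intro q
    refine closure_minimal (fun g hg => ?_) (hCG.isClosed)
    by_contra h
    exact hg (hΘ0 q _ h)
  have hwall : ∀ j j' : Fin 3, j ≠ 1 → j' ≠ 1 → Circle.exp (pw j) = Circle.exp (pw j') := by
    have hkey : ∀ j : Fin 3, j ≠ 1 → Circle.exp (pw j) = Circle.exp (pw 0) := by
      intro j hj
      fin_cases j
      · rfl
      · exact absurd rfl hj
      · exact h02c.symm
    exact fun j j' hj hj' => (hkey j hj).trans (hkey j' hj').symm
  have hstab := stabilizer_single_le_centralizer_gprimeBlock_of_wall L α S' hα (hreal w) hw' 1 (fun _ => pw) hwall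
  -- the box: slot `1` simple
  have hUo : IsOpen {cw : Fin 3 → ℝ | ∀ j : Fin 3, j ≠ 1 → Circle.exp (cw 1) ≠ Circle.exp (cw j)} := by
    have h : {cw : Fin 3 → ℝ | ∀ j : Fin 3, j ≠ 1 → Circle.exp (cw 1) ≠ Circle.exp (cw j)} = ⋂ j : Fin 3, {cw | j ≠ 1 → Circle.exp (cw 1) ≠ Circle.exp (cw j)} := by
      ext cw; simp only [Set.mem_setOf_eq, Set.mem_iInter]
    rw [h]
    refine isOpen_iInter_of_finite fun j => ?_
    by_cases hj : j = 1
    · have h' : {cw : Fin 3 → ℝ | j ≠ 1 → Circle.exp (cw 1) ≠ Circle.exp (cw j)} = Set.univ := Set.eq_univ_of_forall fun cw h => absurd hj h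
      rw [h']; exact isOpen_univ
    · have h' : {cw : Fin 3 → ℝ | j ≠ 1 → Circle.exp (cw 1) ≠ Circle.exp (cw j)} = {cw | Circle.exp (cw 1) ≠ Circle.exp (cw j)} :=
        Set.ext fun cw => ⟨fun h => h hj, fun h _ => h⟩
      rw [h']
      exact isOpen_ne_fun (Circle.exp.continuous.comp (continuous_apply 1)) (Circle.exp.continuous.comp (continuous_apply j))
  have hpU : pw ∈ {cw : Fin 3 → ℝ | ∀ j : Fin 3, j ≠ 1 → Circle.exp (cw 1) ≠ Circle.exp (cw j)} := by
    intro j hj h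
    have := hwall j 0 hj (by decide)
    exact h01 (this ▸ h).symm
  obtain ⟨ε, hε, hball⟩ := Metric.isOpen_iff.1 hUo pw hpU
  have hKU : Metric.closedBall pw (ε / 2) ⊆ {cw : Fin 3 → ℝ | ∀ j : Fin 3, j ≠ 1 → Circle.exp (cw 1) ≠ Circle.exp (cw j)} :=
    (Metric.closedBall_subset_ball (by linarith)).trans hball
  obtain ⟨𝒦, h𝒦, hmem𝒦⟩ := uniformlyProper_gprimeBlock_cpt_of_ne L α S' hα (hreal w) hw' 1 (Subgroup.centralizer ({gprimeBlockAt L α w S' pw} : Set ↥(archLocal L 3 (Matrix.diagonal α) w))) hstab _ hKU (isCompact_closedBall pw (ε / 2)) _ hCG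
  obtain ⟨C'', hC'', hsub⟩ := exists_isCompact_image_mk_superset (Subgroup.centralizer ({gprimeBlockAt L α w S' pw} : Set ↥(archLocal L 3 (Matrix.diagonal α) w))) h𝒦
  have hCM : ∀ q : P, ∀ cw ∈ Metric.ball pw (ε / 2), ∀ y : ↥(archLocal L 3 (Matrix.diagonal α) w),
      y * gprimeBlockAt L α w S' cw * y⁻¹ ∈ tsupport (fun g : ↥(archLocal L 3 (Matrix.diagonal α) w) => Θ (q, ((g : GL (Fin 3) ℂ) : Matrix (Fin 3) (Fin 3) ℂ))) → y ∈ C'' * ((Subgroup.centralizer ({gprimeBlockAt L α w S' pw} : Set ↥(archLocal L 3 (Matrix.diagonal α) w))) : Set ↥(archLocal L 3 (Matrix.diagonal α) w)) := by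
    intro q cw hcw y hy
    obtain ⟨a, ha, hay⟩ := hsub (hmem𝒦 cw (Metric.ball_subset_closedBall hcw) y (hsuppΘ q hy))
    rw [QuotientGroup.eq] at hay
    exact ⟨a, ha, a⁻¹ * y, hay, by group⟩
  -- ### ONE cut-off `β` on `M`
  obtain ⟨β, hβc, hβs, hβ0, -, hβ1⟩ := exists_continuous_hasCompactSupport_integral_comp_mul_eq_one_pos (Subgroup.centralizer ({gprimeBlockAt L α w S' pw} : Set ↥(archLocal L 3 (Matrix.diagonal α) w))) hMc νM (hC''.insert 1)
  have hβ1' : ∀ x ∈ C'', ∀ k₀ : ↥(Subgroup.centralizer ({gprimeBlockAt L α w S' pw} : Set ↥(archLocal L 3 (Matrix.diagonal α) w))), ∫ h : ↥(Subgroup.centralizer ({gprimeBlockAt L α w S' pw} : Set ↥(archLocal L 3 (Matrix.diagonal α) w))), β (x * (k₀ : ↥(archLocal L 3 (Matrix.diagonal α) w)) * (h : ↥(archLocal L 3 (Matrix.diagonal α) w))) ∂νM = 1 :=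
    fun x hx k₀ => hβ1 x (Set.mem_insert_of_mem _ hx) k₀
  -- ### the descended kernel WITH PARAMETERS `Θ_M(q, X) = ∫_G β(y) Θ(q, ↑y X ↑y⁻¹) dν(y)` is jointly smooth (Hörmander engine)
  obtain ⟨ΘM, hΘMdef⟩ : ∃ ΘM : P × Matrix (Fin 3) (Fin 3) ℂ → ℂ, ΘM = fun v => ∫ y : ↥(archLocal L 3 (Matrix.diagonal α) w), β y • Θ (v.1, ((y : GL (Fin 3) ℂ) : Matrix (Fin 3) (Fin 3) ℂ) * v.2 * (((y⁻¹ : ↥(archLocal L 3 (Matrix.diagonal α) w)) : GL (Fin 3) ℂ) : Matrix (Fin 3) (Fin 3) ℂ)) ∂νw := ⟨_, rfl⟩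
  have hΘM : ContDiff ℝ ∞ ΘM := by
    rw [hΘMdef]
    refine contDiff_iff_contDiffAt.2 fun v₀ => ?_
    have hΨ : ContDiff ℝ ∞ fun z : (ℝ × (Matrix (Fin 3) (Fin 3) ℂ × Matrix (Fin 3) (Fin 3) ℂ)) × (P × Matrix (Fin 3) (Fin 3) ℂ) => z.1.1 • Θ (z.2.1, z.1.2.1 * z.2.2 * z.1.2.2) :=
      (contDiff_fst.comp contDiff_fst).smul (hΘ.comp ((contDiff_fst.comp contDiff_snd).prodMk
        (((contDiff_fst.comp (contDiff_snd.comp contDiff_fst)).mul (contDiff_snd.comp contDiff_snd)).mul (contDiff_snd.comp (contDiff_snd.comp contDiff_fst)))))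
    have hy : Continuous fun y : ↥(archLocal L 3 (Matrix.diagonal α) w) => (β y, (((y : GL (Fin 3) ℂ) : Matrix (Fin 3) (Fin 3) ℂ), (((y⁻¹ : ↥(archLocal L 3 (Matrix.diagonal α) w)) : GL (Fin 3) ℂ) : Matrix (Fin 3) (Fin 3) ℂ))) :=
      hβc.prodMk ((Units.continuous_val.comp continuous_subtype_val).prodMk (Units.continuous_val.comp (continuous_subtype_val.comp continuous_inv)))
    exact Literature.Analysis.Calculus.contDiffAt_integral_comp_of_contDiff_of_support νw
      (fun z : (ℝ × (Matrix (Fin 3) (Fin 3) ℂ × Matrix (Fin 3) (Fin 3) ℂ)) × (P × Matrix (Fin 3) (Fin 3) ℂ) => z.1.1 • Θ (z.2.1, z.1.2.1 * z.2.2 * z.1.2.2)) hΨ _ hy v₀ hβs.isCompact Filter.univ_mem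
      (fun t ht X _ => by simp only [image_eq_zero_of_notMem_tsupport ht, zero_smul])
  have haM : ∀ (q : P) (m : ↥(Subgroup.centralizer ({gprimeBlockAt L α w S' pw} : Set ↥(archLocal L 3 (Matrix.diagonal α) w)))), (fun m : ↥(Subgroup.centralizer ({gprimeBlockAt L α w S' pw} : Set ↥(archLocal L 3 (Matrix.diagonal α) w))) => ∫ x, β x • Θ (q, (((x * (m : ↥(archLocal L 3 (Matrix.diagonal α) w)) * x⁻¹ : ↥(archLocal L 3 (Matrix.diagonal α) w)) : GL (Fin 3) ℂ) : Matrix (Fin 3) (Fin 3) ℂ)) ∂νw) m = ΘM (q, (((m : ↥(archLocal L 3 (Matrix.diagonal α) w)) : GL (Fin 3) ℂ) : Matrix (Fin 3) (Fin 3) ℂ)) := by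
    intro q m
    rw [hΘMdef]
    simp only [Subgroup.coe_mul, Units.val_mul, InvMemClass.coe_inv]
  have haMc : ∀ q : P, Continuous (fun m : ↥(Subgroup.centralizer ({gprimeBlockAt L α w S' pw} : Set ↥(archLocal L 3 (Matrix.diagonal α) w))) => ∫ x, β x • Θ (q, (((x * (m : ↥(archLocal L 3 (Matrix.diagonal α) w)) * x⁻¹ : ↥(archLocal L 3 (Matrix.diagonal α) w)) : GL (Fin 3) ℂ) : Matrix (Fin 3) (Fin 3) ℂ)) ∂νw) := fun q => by
    have h : (fun m : ↥(Subgroup.centralizer ({gprimeBlockAt L α w S' pw} : Set ↥(archLocal L 3 (Matrix.diagonal α) w))) => ∫ x, β x • Θ (q, (((x * (m : ↥(archLocal L 3 (Matrix.diagonal α) w)) * x⁻¹ : ↥(archLocal L 3 (Matrix.diagonal α) w)) : GL (Fin 3) ℂ) : Matrix (Fin 3) (Fin 3) ℂ)) ∂νw) = fun m : ↥(Subgroup.centralizer ({gprimeBlockAt L α w S' pw} : Set ↥(archLocal L 3 (Matrix.diagonal α) w))) => ΘM (q, ((((m : ↥(Subgroup.centralizer ({gprimeBlockAt L α w S' pw}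 : Set ↥(archLocal L 3 (Matrix.diagonal α) w)))) : ↥(archLocal L 3 (Matrix.diagonal α) w)) : GL (Fin 3) ℂ) : Matrix (Fin 3) (Fin 3) ℂ)) := funext (haM q)
    rw [h]
    exact hΘM.continuous.comp (continuous_const.prodMk (Units.continuous_val.comp (continuous_subtype_val.comp continuous_subtype_val)))
  have haMs : ∀ q : P, HasCompactSupport (fun m : ↥(Subgroup.centralizer ({gprimeBlockAt L α w S' pw} : Set ↥(archLocal L 3 (Matrix.diagonal α) w))) => ∫ x, β x • Θ (q, (((x * (m : ↥(archLocal L 3 (Matrix.diagonal α) w)) * x⁻¹ : ↥(archLocal L 3 (Matrix.diagonal α) w)) : GL (Fin 3) ℂ) : Matrix (Fin 3) (Fin 3) ℂ)) ∂νw) := fun q =>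
    hasCompactSupport_integral_conj νw _ hMc hβs ((hCG.of_isClosed_subset (isClosed_tsupport _) (hsuppΘ q)))
  -- ### the smooth ambient reading of `e′⁻¹`: the block pattern `Λ` ([8]) and the frame matrix `M₀` of `φ`
  obtain ⟨Tm, hTm⟩ : ∃ Tm : GL (Fin 3) ℂ, Tm = Matrix.GeneralLinearGroup.mkOfDetNeZero _ (det_monomial_one_ne_zero 3 (lineOf (formSign L α w))) := ⟨_, rfl⟩
  obtain ⟨Λ, hΛ⟩ : ∃ Λ : Matrix (Fin 2) (Fin 2) ℂ → Matrix (Fin 3) (Fin 3) ℂ, Λ = fun X =>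
      (Tm : Matrix (Fin 3) (Fin 3) ℂ) * (!![X 0 0, 0, X 0 1; 0, 1, 0; X 1 0, 0, X 1 1] : Matrix (Fin 3) (Fin 3) ℂ) * ((Tm⁻¹ : GL (Fin 3) ℂ) : Matrix (Fin 3) (Fin 3) ℂ) := ⟨_, rfl⟩
  have hΛc : ContDiff ℝ ∞ Λ := by rw [hΛ]; exact (contDiff_const.mul contDiff_blockPattern).mul contDiff_const
  have hΛb : ∀ b : ↥(unitaryGroupOfForm (starRingEnd ℂ) ((Matrix.diagonal ![α (lineOf (formSign L α w) 0), α (lineOf (formSign L α w) 2)]).map w.1.embedding)), ((((e.symm (b, 1) : ↥(Subgroup.centralizer ({gprimeBlockAt L α w S' pw} : Set ↥(archLocal L 3 (Matrix.diagonal α) w)))) : ↥(archLocal L 3 (Matrix.diagonal α) w)) : GL (Fin 3) ℂ) : Matrix (Fin 3) (Fin 3) ℂ) = Λ ((b : GL (Fin 2) ℂ) : Matrix (Fin 2) (Fin 2) ℂ) := by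
    intro b
    rw [h8 b]
    have h1 : ((((1 : ↥(unitaryGroupOfForm (starRingEnd ℂ) ((Matrix.diagonal ![(α ∘ (lineOf (formSign L α w))) 1]).map w.1.embedding))) : GL (Fin 1) ℂ) :
        Matrix (Fin 1) (Fin 1) ℂ) 0 0) = 1 := by
      rw [OneMemClass.coe_one, Units.val_one, Matrix.one_apply_eq]
    rw [ContinuousMulEquiv.coe_restrictSubgroup_apply, GLn.conjEquiv_apply, Units.val_mul, Units.val_mul, coe_endoEmb, coe_endoGL_eq, h1, hΛ, hTm]
  obtain ⟨M₀, hM₀⟩ : ∃ M₀ : GL (Fin 2) ℂ, ∀ h : ↥(unitaryGroupOfForm (starRingEnd ℂ) ((Matrix.diagonal ![α (lineOf (formSign L α w) 0), α (lineOf (formSign L α w) 2)]).map w.1.embedding)), ((φ h : ↥(unitaryGroupOfForm (starRingEnd ℂ) J)) : GL (Fin 2) ℂ) = M₀ * (h : GL (Fin 2) ℂ) * M₀⁻¹ :=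
    ⟨_, fun h => by rw [hval h, _root_.mul_inv_rev]⟩
  have hφsymm : ∀ u : ↥(unitaryGroupOfForm (starRingEnd ℂ) J), (((φ.symm u : ↥(unitaryGroupOfForm (starRingEnd ℂ) ((Matrix.diagonal ![α (lineOf (formSign L α w) 0), α (lineOf (formSign L α w) 2)]).map w.1.embedding))) : GL (Fin 2) ℂ) : Matrix (Fin 2) (Fin 2) ℂ) =
      ((M₀⁻¹ : GL (Fin 2) ℂ) : Matrix (Fin 2) (Fin 2) ℂ) * ((u : GL (Fin 2) ℂ) : Matrix (Fin 2) (Fin 2) ℂ) * ((M₀ : GL (Fin 2) ℂ) : Matrix (Fin 2) (Fin 2) ℂ) := fun u => by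
    have h := hM₀ (φ.symm u)
    rw [ContinuousMulEquiv.apply_symm_apply] at h
    have h' : ((φ.symm u : ↥(unitaryGroupOfForm (starRingEnd ℂ) ((Matrix.diagonal ![α (lineOf (formSign L α w) 0), α (lineOf (formSign L α w) 2)]).map w.1.embedding))) : GL (Fin 2) ℂ) = M₀⁻¹ * (u : GL (Fin 2) ℂ) * M₀ := by rw [h]; group
    rw [h', Units.val_mul, Units.val_mul]
  have hsymm : ∀ (u : ↥(unitaryGroupOfForm (starRingEnd ℂ) J)) (r : ↥K), e'.symm (u, r) = e.symm (φ.symm u, 1) * (r : ↥(Subgroup.centralizer ({gprimeBlockAt L α w S' pw} : Set ↥(archLocal L 3 (Matrix.diagonal α) w)))) := fun u r => by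
    rw [he's]
    apply e.injective
    rw [ContinuousMulEquiv.apply_symm_apply, map_mul, ContinuousMulEquiv.apply_symm_apply, h10 _ r.2]
    ext <;> simp
  -- ONE ambient cut-off `χ ≡ 1` on the image of the common compact support `C″·?` — we cut off on the compact `φ(pr₁(e(M ∩ coe⁻¹ CΘ-conjugates)))`: use the image of `{m ∈ M | ↑m ∈ C_G}`
  have hS₀ : IsCompact ((fun u : ↥(unitaryGroupOfForm (starRingEnd ℂ) J) => ((u : GL (Fin 2) ℂ) : Matrix (Fin 2) (Fin 2) ℂ)) '' (Prod.fst '' (e' '' {m : ↥(Subgroup.centralizer ({gprimeBlockAt L α w S' pw} : Set ↥(archLocal L 3 (Matrix.diagonal α) w))) | (m : ↥(archLocal L 3 (Matrix.diagonal α) w)) ∈ {g : ↥(archLocal L 3 (Matrix.diagonal α) w) | ∃ x ∈ tsupport β, ∃ g' : ↥(archLocal L 3 (Matrix.diagonal α) w), ((g' : GL (Fin 3) ℂ) : Matrix (Fin 3) (Fin 3) ℂ) ∈ CΘ ∧ (g : ↥(archLocal L 3 (Matrix.diagonal α) w)) = x⁻¹ * g' * x}}))) := by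
    have h1 : IsCompact {g : ↥(archLocal L 3 (Matrix.diagonal α) w) | ∃ x ∈ tsupport β, ∃ g' : ↥(archLocal L 3 (Matrix.diagonal α) w), ((g' : GL (Fin 3) ℂ) : Matrix (Fin 3) (Fin 3) ℂ) ∈ CΘ ∧ g = x⁻¹ * g' * x} := by
      have h : {g : ↥(archLocal L 3 (Matrix.diagonal α) w) | ∃ x ∈ tsupport β, ∃ g' : ↥(archLocal L 3 (Matrix.diagonal α) w), ((g' : GL (Fin 3) ℂ) : Matrix (Fin 3) (Fin 3) ℂ) ∈ CΘ ∧ g = x⁻¹ * g' * x} =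
          (fun z : ↥(archLocal L 3 (Matrix.diagonal α) w) × ↥(archLocal L 3 (Matrix.diagonal α) w) => z.1⁻¹ * z.2 * z.1) '' (tsupport β ×ˢ {g : ↥(archLocal L 3 (Matrix.diagonal α) w) | ((g : GL (Fin 3) ℂ) : Matrix (Fin 3) (Fin 3) ℂ) ∈ CΘ}) := by
        ext g
        simp only [Set.mem_setOf_eq, Set.mem_image, Set.mem_prod, Prod.exists]
        constructor
        · rintro ⟨x, hx, g', hg', rfl⟩; exact ⟨x, g', ⟨hx, hg'⟩, rfl⟩
        · rintro ⟨x, g', ⟨hx, hg'⟩, rfl⟩; exact ⟨x, hx, g', hg', rfl⟩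
      rw [h]
      exact (hβs.isCompact.prod hCG).image ((continuous_fst.inv.mul continuous_snd).mul continuous_fst)
    have h2 : IsCompact {m : ↥(Subgroup.centralizer ({gprimeBlockAt L α w S' pw} : Set ↥(archLocal L 3 (Matrix.diagonal α) w))) | (m : ↥(archLocal L 3 (Matrix.diagonal α) w)) ∈ {g : ↥(archLocal L 3 (Matrix.diagonal α) w) | ∃ x ∈ tsupport β, ∃ g' : ↥(archLocal L 3 (Matrix.diagonal α) w), ((g' : GL (Fin 3) ℂ) : Matrix (Fin 3) (Fin 3) ℂ) ∈ CΘ ∧ (g : ↥(archLocal L 3 (Matrix.diagonal α) w)) = x⁻¹ * g' * x}} :=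
      hMc.isClosedEmbedding_subtypeVal.isCompact_preimage h1
    exact ((h2.image e'.continuous).image continuous_fst).image (Units.continuous_val.comp continuous_subtype_val)
  obtain ⟨χ, hχd, hχc, hχ1, -⟩ := Literature.Analysis.Calculus.exists_contDiff_hasCompactSupport_eq_one_of_isCompact hS₀
  -- off that compact set the descended kernel vanishes, for EVERY parameter
  have haM0 : ∀ (q : P) (m : ↥(Subgroup.centralizer ({gprimeBlockAt L α w S' pw} : Set ↥(archLocal L 3 (Matrix.diagonal α) w)))), (m : ↥(archLocal L 3 (Matrix.diagonal α) w)) ∉ {g : ↥(archLocal L 3 (Matrix.diagonal α) w) | ∃ x ∈ tsupport β, ∃ g' : ↥(archLocal L 3 (Matrix.diagonal α) w), ((g' : GL (Fin 3) ℂ) : Matrix (Fin 3) (Fin 3) ℂ) ∈ CΘ ∧ g = x⁻¹ * g' * x} → (fun m : ↥(Subgroup.centralizer ({gprimeBlockAt L α w S' pw} : Set ↥(archLocal L 3 (Matrix.diagonal α) w))) => ∫ x, β x • Θ (q, (((x * (m : ↥(archLocal L 3 (Matrix.diagonal α) w)) * x⁻¹ : ↥(archLocal L 3 (Matrix.diagonal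 α) w)) : GL (Fin 3) ℂ) : Matrix (Fin 3) (Fin 3) ℂ)) ∂νw) m = 0 := by
    intro q m hm
    refine integral_eq_zero_of_ae (Filter.Eventually.of_forall fun x => ?_)
    by_cases hx : x ∈ tsupport β
    · have hne : (((x * (m : ↥(archLocal L 3 (Matrix.diagonal α) w)) * x⁻¹ : ↥(archLocal L 3 (Matrix.diagonal α) w)) : GL (Fin 3) ℂ) : Matrix (Fin 3) (Fin 3) ℂ) ∉ CΘ := by
        intro hc
        exact hm ⟨x, hx, x * (m : ↥(archLocal L 3 (Matrix.diagonal α) w)) * x⁻¹, hc, by group⟩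
      simp only [Pi.zero_apply, hΘ0 q _ hne, smul_zero]
    · simp only [Pi.zero_apply, image_eq_zero_of_notMem_tsupport hx, zero_smul]
  -- ### the family `f`
  have hR : ContDiff ℝ ∞ fun cw : Fin 3 → ℝ => (((gprimeBlockAt L α w S' ![0, cw 1, 0] : ↥(archLocal L 3 (Matrix.diagonal α) w)) : GL (Fin 3) ℂ) : Matrix (Fin 3) (Fin 3) ℂ) := by
    have hlin : ContDiff ℝ ∞ fun cw : Fin 3 → ℝ => (![0, cw 1, 0] : Fin 3 → ℝ) := by
      refine contDiff_pi.2 fun i => ?_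
      fin_cases i
      · exact contDiff_const
      · exact contDiff_apply ℝ ℝ 1
      · exact contDiff_const
    exact (contDiff_coe_gprimeBlock L α S' w).comp (contDiff_pi.2 fun _ => hlin)
  obtain ⟨f, hf⟩ : ∃ f : (P × (Fin 3 → ℝ)) × Matrix (Fin 2) (Fin 2) ℂ → ℂ, f = fun z =>
      (χ z.2 : ℂ) * ΘM (z.1.1, Λ (((M₀⁻¹ : GL (Fin 2) ℂ) : Matrix (Fin 2) (Fin 2) ℂ) * z.2 * ((M₀ : GL (Fin 2) ℂ) : Matrix (Fin 2) (Fin 2) ℂ)) *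
        (((gprimeBlockAt L α w S' ![0, z.1.2 1, 0] : ↥(archLocal L 3 (Matrix.diagonal α) w)) : GL (Fin 3) ℂ) : Matrix (Fin 3) (Fin 3) ℂ)) := ⟨_, rfl⟩
  have hfs : ContDiff ℝ ∞ f := by
    rw [hf]
    refine ((Complex.ofRealCLM.contDiff.comp ((hχd ⊤).comp contDiff_snd)).mul
      (hΘM.comp ((contDiff_fst.comp contDiff_fst).prodMk
        ((hΛc.comp ((contDiff_const.mul contDiff_snd).mul contDiff_const)).mul (hR.comp (contDiff_snd.comp contDiff_fst))))))
  -- `f ((q, cw), ↑↑u) = (a′)_M^β(q)(e′⁻¹(u, r))` whenever `↑r = γ_w(0, cw_1, 0)`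
  have hfB : ∀ (q : P) (cw : Fin 3 → ℝ) (u : ↥(unitaryGroupOfForm (starRingEnd ℂ) J)) (r : ↥K),
      ((r : ↥(Subgroup.centralizer ({gprimeBlockAt L α w S' pw} : Set ↥(archLocal L 3 (Matrix.diagonal α) w)))) : ↥(archLocal L 3 (Matrix.diagonal α) w)) = gprimeBlockAt L α w S' ![0, cw 1, 0] →
      (fun m : ↥(Subgroup.centralizer ({gprimeBlockAt L α w S' pw} : Set ↥(archLocal L 3 (Matrix.diagonal α) w))) => ∫ x, β x • Θ (q, (((x * (m : ↥(archLocal L 3 (Matrix.diagonal α) w)) * x⁻¹ : ↥(archLocal L 3 (Matrix.diagonal α) w)) : GL (Fin 3) ℂ) : Matrix (Fin 3) (Fin 3) ℂ)) ∂νw) (e'.symm (u, r)) = f ((q, cw), ((u : GL (Fin 2) ℂ) : Matrix (Fin 2) (Fin 2) ℂ)) := by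
    intro q cw u r hr
    have haM' := haM q (e'.symm (u, r))
    beta_reduce at haM'
    beta_reduce
    have hread : ΘM (q, ((((e'.symm (u, r) : ↥(Subgroup.centralizer ({gprimeBlockAt L α w S' pw} : Set ↥(archLocal L 3 (Matrix.diagonal α) w)))) : ↥(archLocal L 3 (Matrix.diagonal α) w)) : GL (Fin 3) ℂ) : Matrix (Fin 3) (Fin 3) ℂ)) =
        ΘM (q, Λ (((M₀⁻¹ : GL (Fin 2) ℂ) : Matrix (Fin 2) (Fin 2) ℂ) * ((u : GL (Fin 2) ℂ) : Matrix (Fin 2) (Fin 2) ℂ) * ((M₀ : GL (Fin 2) ℂ) : Matrix (Fin 2) (Fin 2) ℂ)) *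
          (((gprimeBlockAt L α w S' ![0, cw 1, 0] : ↥(archLocal L 3 (Matrix.diagonal α) w)) : GL (Fin 3) ℂ) : Matrix (Fin 3) (Fin 3) ℂ)) := by
      rw [hsymm]
      simp only [Subgroup.coe_mul, Units.val_mul]
      rw [hΛb (φ.symm u), hφsymm u, hr]
    by_cases hu : ((e'.symm (u, r) : ↥(Subgroup.centralizer ({gprimeBlockAt L α w S' pw} : Set ↥(archLocal L 3 (Matrix.diagonal α) w)))) : ↥(archLocal L 3 (Matrix.diagonal α) w)) ∈ {g : ↥(archLocal L 3 (Matrix.diagonal α) w) | ∃ x ∈ tsupport β, ∃ g' : ↥(archLocal L 3 (Matrix.diagonal α) w), ((g' : GL (Fin 3) ℂ) : Matrix (Fin 3) (Fin 3) ℂ) ∈ CΘ ∧ g = x⁻¹ * g' * x}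
    · have hχu : χ ((u : GL (Fin 2) ℂ) : Matrix (Fin 2) (Fin 2) ℂ) = 1 :=
        hχ1 _ ⟨u, ⟨(u, r), ⟨e'.symm (u, r), hu, e'.apply_symm_apply _⟩, rfl⟩, rfl⟩
      rw [hf]
      dsimp only
      rw [hχu, Complex.ofReal_one, one_mul, haM', hread]
    · have h0 := haM0 q _ hu
      beta_reduce at h0
      have h0' := h0
      rw [haM', hread] at h0'
      rw [h0, hf]
      dsimp only
      rw [h0', mul_zero]
  -- ### the descent constant
  have htuniv : (Measure.map (Subgroup.subgroupOfEquivOfLe hT).symm tT) Set.univ = tT Set.univ := by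
    rw [Measure.map_apply (continuous_subgroupOfEquivOfLe_symm (chartTorusGLoc L α w S') (Subgroup.centralizer ({gprimeBlockAt L α w S' pw} : Set ↥(archLocal L 3 (Matrix.diagonal α) w))) hT).measurable MeasurableSet.univ, Set.preimage_univ]
  have ht0 : tT Set.univ ≠ 0 := IsOpenPosMeasure.open_pos _ isOpen_univ Set.univ_nonempty
  have htpos : 0 < (tT Set.univ).toReal := ENNReal.toReal_pos ht0 (measure_ne_top _ _)
  -- ### the block reading of the chart point through `e′` ([5] + (B-STD) (i))
  have hγ : ∀ cw : Fin 3 → ℝ,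
      e' ⟨gprimeBlockAt L α w S' cw, chartTorusGLoc_le_centralizer L α w S' pw (gprimeBlockAt_mem_chartTorusGLoc L α w S' cw)⟩ =
        ((⟨Matrix.GeneralLinearGroup.mkOfDetNeZero !![(1 : ℂ), 1; 1, -1] det_cayleyTwo_ne_zero * circleDiagonal 2 ![Circle.exp (cw 0), Circle.exp (cw 2)] * (Matrix.GeneralLinearGroup.mkOfDetNeZero !![(1 : ℂ), 1; 1, -1] det_cayleyTwo_ne_zero)⁻¹, cayley_conj_circleDiagonal_mem_of_eq_over hJ _⟩ : ↥(unitaryGroupOfForm (starRingEnd ℂ) J)),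
          (e ⟨gprimeBlockAt L α w S' cw, chartTorusGLoc_le_centralizer L α w S' pw (gprimeBlockAt_mem_chartTorusGLoc L α w S' cw)⟩).2) := by
    intro cw
    have h1 : (e ⟨gprimeBlockAt L α w S' cw, chartTorusGLoc_le_centralizer L α w S' pw (gprimeBlockAt_mem_chartTorusGLoc L α w S' cw)⟩).1 =
        ⟨circleDiagonal 2 ![Circle.exp (cw 0), Circle.exp (cw 2)], circleDiagonal_mem_unitaryGroupOfForm_diagonal_map_weights w.1.embedding ![α (lineOf (formSign L α w) 0), α (lineOf (formSign L α w) 2)] _⟩ :=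
      Subtype.ext (h5 cw)
    rw [he', h1, hφ]
  -- ### assembling
  have hΘM0 : ∀ q : P, (∀ X, Θ (q, X) = 0) → ∀ A, ΘM (q, A) = 0 := by
    intro q hq A
    rw [hΘMdef]
    simp only [hq, smul_zero, integral_zero]
  refine ⟨(tT Set.univ).toReal * (κ : ℝ), Metric.ball pw (ε / 2), f, tsupport χ,
    mul_ne_zero htpos.ne' (NNReal.coe_ne_zero.2 hκ), Metric.isOpen_ball,
    Metric.mem_ball_self (half_pos hε), hfs, hχc, fun q X hX => ?_, fun q hq cw X => ?_, fun q cw X => ?_, ?_⟩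
  · rw [hf]; dsimp only; rw [image_eq_zero_of_notMem_tsupport hX, Complex.ofReal_zero, zero_mul]
  · rw [hf]; dsimp only; rw [hΘM0 q hq, mul_zero]
  · rw [hf]; dsimp only
    simp only [Matrix.cons_val_one, Matrix.cons_val_zero]
  intro q cw hcw hreg
  -- the group integral as a quotient integral (compact torus), then Harish-Chandra's descent, then the block reduction
  have hTγ : ∀ s ∈ chartTorusGLoc L α w S', s * gprimeBlockAt L α w S' cw = gprimeBlockAt L α w S' cw * s := forall_mem_chartTorusGLoc_comm L α w S' cw
  letI : MeasurableSpace (↥(archLocal L 3 (Matrix.diagonal α) w) ⧸ chartTorusGLoc L α w S') := borel _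
  haveI : BorelSpace (↥(archLocal L 3 (Matrix.diagonal α) w) ⧸ chartTorusGLoc L α w S') := ⟨rfl⟩
  -- (HYP) at the regular point `cw`: integrability on `G ⧸ T`
  obtain ⟨𝒦₁, h𝒦₁, hmem𝒦₁⟩ := uniformlyProper_gprimeBlock_cpt_of_injective L α S' hα hw' (chartTorusGLoc L α w S') {cw}
    (Set.singleton_subset_iff.2 hreg) isCompact_singleton _ hCG
  have hint : Integrable (descConj (gprimeBlockAt L α w S' cw) (chartTorusGLoc L α w S') hTγ (fun g : ↥(archLocal L 3 (Matrix.diagonal α) w) => Θ (q, ((g : GL (Fin 3) ℂ) : Matrix (Fin 3) (Fin 3) ℂ))))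
      (quotientMeasure (chartTorusGLoc L α w S') tT (isClosed_chartTorusGLoc L α w S') νw) :=
    integrable_descConj_of_exists_isCompact (chartTorusGLoc L α w S') (isClosed_chartTorusGLoc L α w S') _ hTγ
      (hΘ.continuous.comp (continuous_const.prodMk (Units.continuous_val.comp continuous_subtype_val))) h𝒦₁
      (fun y hy => hmem𝒦₁ cw rfl y (hsuppΘ q hy)) _
  have hgrp : ∫ g : ↥(archLocal L 3 (Matrix.diagonal α) w), Θ (q, (((g * gprimeBlockAt L α w S' cw * g⁻¹ : ↥(archLocal L 3 (Matrix.diagonal α) w)) : GL (Fin 3) ℂ) : Matrix (Fin 3) (Fin 3) ℂ)) ∂νw =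
      ((tT Set.univ).toReal : ℂ) * ∫ yq, descConj (gprimeBlockAt L α w S' cw) (chartTorusGLoc L α w S') hTγ
        (fun g : ↥(archLocal L 3 (Matrix.diagonal α) w) => Θ (q, ((g : GL (Fin 3) ℂ) : Matrix (Fin 3) (Fin 3) ℂ))) yq ∂(quotientMeasure (chartTorusGLoc L α w S') tT (isClosed_chartTorusGLoc L α w S') νw) := by
    rw [quotientMeasure_eq_inv_smul_map_mk, integral_smul_measure,
      integral_map (QuotientGroup.continuous_mk.measurable.aemeasurable) (Continuous.aestronglyMeasurable ?_)]
    · simp only [descConj_mk, ENNReal.toReal_inv, Complex.real_smul, Complex.ofReal_inv]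
      rw [← mul_assoc, mul_inv_cancel₀ (Complex.ofReal_ne_zero.2 htpos.ne'), one_mul]
    · exact continuous_descConj_gprimeBlockAt L α w S' _ (hΘ.continuous.comp (continuous_const.prodMk (Units.continuous_val.comp continuous_subtype_val))) cw
  have hdesc := integral_descConj_eq_integral_descConj_descended (ψ := fun g : ↥(archLocal L 3 (Matrix.diagonal α) w) => Θ (q, ((g : GL (Fin 3) ℂ) : Matrix (Fin 3) (Fin 3) ℂ))) νw (Subgroup.centralizer ({gprimeBlockAt L α w S' pw} : Set ↥(archLocal L 3 (Matrix.diagonal α) w))) hMc νM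
    ⟨gprimeBlockAt L α w S' cw, chartTorusGLoc_le_centralizer L α w S' pw (gprimeBlockAt_mem_chartTorusGLoc L α w S' cw)⟩ (chartTorusGLoc L α w S') (isClosed_chartTorusGLoc L α w S') hTγ
    ((chartTorusGLoc L α w S').subgroupOf (Subgroup.centralizer ({gprimeBlockAt L α w S' pw} : Set ↥(archLocal L 3 (Matrix.diagonal α) w)))) hTc
    (fun t ht => Subtype.ext (hTγ (t : ↥(archLocal L 3 (Matrix.diagonal α) w)) (Subgroup.mem_subgroupOf.1 ht))) (fun t ht => Subgroup.mem_subgroupOf.1 ht)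
    tT (Measure.map (Subgroup.subgroupOfEquivOfLe hT).symm tT) (eq_map_incl_map_subgroupOfEquivOfLe_symm hT tT)
    hβc hβs hβ0 hβ1' (hΘ.continuous.comp (continuous_const.prodMk (Units.continuous_val.comp continuous_subtype_val))) hint (hCM q cw hcw)
  rw [hgrp]
  erw [hdesc]
  rw [integral_descConj_eq_smul_integral_of_block _ _ e' Ψ hΨ _ μ₀ hmap _ _ _ (hγ cw) _ (haMc q), NNReal.smul_def, Complex.real_smul, ← mul_assoc,
    Complex.real_smul, Complex.ofReal_mul]
  congr 1
  refine integral_congr_ae (Filter.Eventually.of_forall fun b => ?_)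
  exact hfB q cw _ _ (h6 cw)

end Descent

end Literature.NumberTheory.Rogawski1990

end
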